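import Literature.MathematicalPhysics.QuantumFieldTheory.Balaban1983to89.B4Lower18RegularRegion

/-!
# `Balaban1983to89.B4BoxNeumannGauge` — [Balaban1983RegularityDecay] p. 579 «we can apply Lemma 2.2 to all operators
# in it» for the BOUNDARY CUBES of a parallelepiped: an explicit lattice gauge on a box after which a (1.7)-regular field
# has `O(κ)` normal components on every face and stays (1.7)-regular, so that its reflected `2N`-periodic pullback is
# (1.7)-regular on all of `ηℤ^{d+1}` (the «discrete Neumann gauge» asked for in HOME/GAPS.md G-B4-p17-02 (v-1))

statement-level skeleton of published theorems with citation tags; proofs where landed; nothing here is a claim about the Yang–Mills mass gap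

CITATION HEADER.  T. Bałaban, *Regularity and decay of lattice Green's functions*, Commun. Math. Phys. **89** (1983)
571–597, doi:10.1007/bf01214744 [Balaban1983RegularityDecay] (cell paper B4; held text
`paper:balaban1983-cmp89-regularity-decay`, journal page = PDF page + 570; p. 572 [PDF 2] (1.7), p. 575 [PDF 5],
p. 577 [PDF 7], p. 579 [PDF 9], p. 581 [PDF 11], p. 584 [PDF 14] (2.42)).  Unit `lit-balaban-r04` gen 14 (B7 brief-block
owner, B4 second reader; HOME `run/shared/lean/pub/lit-balaban/`), SKELETON rows **B4.Thm@573** / **B4.Lem2.2** (support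
cells: the field at the boundary cubes), HOME/GAPS.md **G-B4-p17-02** (p17 g5 reading note; r01 g11 ADDENDUM (i)–(vi)).
Imports `B4Lower18RegularRegion` (`compField`, `e1`; through it `B4Reflection242`: `boxDom`, `fold1`, `foldBox`).

WHAT IS PRINTED.  p. 575 [PDF 5] L22–23: «if □_j intersects the boundary of Ω, then Ã_j = A; if □_j is an interior cube
of Ω, then we take Ã_j as equal to A on the cube {x : |x − Mj| ≤ (7/8)M}, and changing regularly to a constant function in
a neighbourhood of a boundary of □_j».  p. 577 [PDF 7] L32–34, Lemma 2.2: «Let a rectangular parallelepiped □ be a sum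
of few large blocks … and let Ã be a regular vector field configuration in the sense of Proposition I.2.1, constant in
a neighbourhood of the boundary of □».  p. 579 [PDF 9] L25–28: «Finally let us notice that if Ω is a rectangular
parallelepiped, then all □_j in the representation (2.13) are cubes and we can apply Lemma 2.2 to all operators in it,
so the restriction dist({x,x′},Ω^c) ≥ R₀ is unnecessary. Thus we have proved the theorem, or rather reduced it to
Lemmas 2.1, 2.2.»  p. 581 [PDF 11] L30–31: «Only here we needed the assumption that A is constant in a neighbourhood of
∂□».  p. 584 [PDF 14] L6–10: «This part of the argument is valid for an arbitrary rectangular parallelepiped □ built of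
unit blocks … We represent G_j(□) with the help of the propagator G_j with free boundary conditions on ξZ^d using the
multiple reflection method.»  (1.7) p. 572: «|(∂^η_μ A)(x)| ≤ c e^{β−1}».

THE GAP THIS FILE SERVES (HOME/GAPS.md G-B4-p17-02, reading note, nothing printed is claimed to fail).  At a boundary
cube the configuration is `Ã_j = A` (p. 575), which is (1.7)-regular but NOT «constant in a neighbourhood of the boundary
of □» (p. 577); the print does not say how Lemma 2.2 is applied there (p. 579).  The lineage's box theorems at a
regular field (`B4Thm110BoxUniform`, `B4Thm19BoxHolderUniform`, `B4Thm112BoxValue`, p17) therefore carry the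
hypothesis «A constant on the collar of width K at ∂Ω».  r01 g11's ADDENDUM (v-1) names what would let the multiple
reflection method (p. 584, `B4Reflection242`) run at a non-constant field: a gauge `λ` on the box with
`∂_nλ = −A_n + O(κ)` on every face and all second differences `|∂∂λ| ≤ C(d)κ` uniformly in the box — «neither is in print
or in the tree».  THIS FILE CONSTRUCTS SUCH A GAUGE EXPLICITLY AND PROVES ITS ESTIMATES, with constants depending on `d`
only (no logarithm of the box size, no smallness or isotropy assumption on the box, no smallness of `A`).

WHAT THIS MODULE PROVES (lattice units; the box of sites `Π_μ [0, N_μ) ⊂ ℤ^{d+1}` = `boxDom N`, `N_μ ≥ 3`; a component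
field `Ac : ℤ^{d+1} → ℝ^{d+1}`, `A_ν(x) = Ac x ν` on the bond `(x, x + e_ν)`; hypothesis (1.7) in the lineage's form
`∀ x ∈ boxDom N, ∀ i ν, |Ac (x + e_i) ν − Ac x ν| ≤ κ`).
* §1–§2 (engine, [folklore]): the centred one-dimensional averages `A^ν_q` and the cube average `S_q = Π_ν A^ν_q`; the
  weighted kernels `ρ_r = r·S_{r−1}` and `P_m = ρ_{m+1} − ρ_m` (`P_0 = id`); `|∂_i∂_ν(ρ_r F)| ≤ 2·Lip_i(F)` (`d2_rho_le`:
  the window of `A^ν` telescopes `∂_ν`, the gain `(2r−1)^{-1}` beats the weight `r`); `|P_m F| ≤ (2(d+1)+1)‖F‖_∞`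
  (`pk_bound`); `|P_{m+1}F − P_m F| ≤ (4(d+1)² + 5(d+1))·Lip(F)` (`pk_step_le`, by a discrete Leibniz rule over the
  directions and the one-dimensional second scale-difference `(q+1)|A_{q+2}f − 2A_{q+1}f + A_q f| ≤ 5 Lip(f)`).
* §3: the face data of direction `μ` — `g⁰_μ` / `g¹_μ` = the normal components on the first / last bond layer
  (`x_μ = 0` / `x_μ = N_μ − 2`), evenly extended to `ℤ^{d+1}` through `foldBox` — inherit (1.7) in every direction
  (`faceLo_lip`, `faceHi_lip`), differ by `≤ (N_μ−2)κ`, and their affine interpolation `G^μ_s` (`faceData`) is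
  `κ`-Lipschitz with constant increment `δ^μ` of size `≤ κ` and Lipschitz constant `≤ 2κ/(N_μ−2)`.
* §4: the scale schedule `m(s) = min(s, N_μ−2−s)`; Abel summation of `Λ^μ_n = Σ_{s<n} P_{m(s)}G^μ_s` on its two monotone
  runs (`sum_pk_inc`, `sum_pk_dec`); `|∂_i∂_ν Λ^μ_n| ≤ 14κ` uniformly in `n ≤ N_μ − 1` (`d2_runSum_le`).
* §5: **the gauge** `λ = Σ_μ λ_μ`, `λ_μ(x) = −Λ^μ_{x_μ}(x)` (`gaugeFn`), **the gauged field** `A'' = A + dλ` (`gauged`;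
  = the lineage's `bondGauge (−λ)` of `A`, `compField_gauged`), and its estimates:
  **`gauged_face_lo` / `gauged_face_hi`**: `|A''_μ(x)| ≤ 14d·κ` for `x ∈ boxDom N` with `x_μ = 0` / `x_μ = N_μ − 2`
  (the normal gauge term cancels `A_μ` exactly since `P_0 = id`; the tangential terms are `O(κ)` because `Λ^ν` is even
  under the mirrors of direction `μ`, which turns a normal first difference at the face into a second difference);
  **`gauged_regular`**: `|A''_ν(x+e_i) − A''_ν(x)| ≤ C₁(d)κ` for parallel box bonds, `C₁(d) = 1 + (d+1)(4(d+1)²+9(d+1)+16)`.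
* §6: **the reflected field** `R*A''` (`reflField`: value on `(z, z+e_ν)` = value of `A''` on the folded bond, `0` on
  mirror-bisected bonds; odd normal / even tangential components — the only choice compatible with the one-parameter
  flow (1.2), GAPS G-B4-p17-02 ADDENDUM (i)); it equals `A''` on the box (`reflField_of_mem`), is `2N`-periodic
  (`reflField_periodic`), and **`reflField_gauged_regular`**: it is (1.7)-regular ON ALL OF `ℤ^{d+1}` with constant
  `max(C₂(d), C₁(d))·κ`, `C₂(d) = 14d` — i.e. a regular torus field on `Π_μ ℤ/2N_μ` in the sense of r01 g9's
  `B4TorusPairFam.torusPairFam.regular` (read with `creg e^{β−1}/n ↦ κ`).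

THE METHOD (OURS, disclosed — the print treats the boundary cubes as read; the continuum analogue is the Whitney–Stein
regularised-distance extension of Lipschitz Neumann data to a `C^{1,1}` function; no held or indexed source states the
lattice version; presearch recorded in the seat notes).  For one face the obvious `λ = x_μ·g(x̂)` fails by a factor of
the box length (tangential second differences of `g` pile up), a tangentially mollified `x_μ·(g ∗ φ_{x_μ})` with box
kernels needs `|A| ≲ κN_μ` at the far face, and summing box-kernel mollifications over the layers costs `log N`; the cure
is the kernel family `P_m = ρ_{m+1} − ρ_m` with `ρ_r = r·(uniform on the cube of radius r−1)`: the partial sums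
`Σ_{m<r} P_m = ρ_r` have first differences of bounded total variation UNIFORMLY in `r`, which is exactly what the
second differences of `Λ` see after Abel summation (the data being affine in the layer index).

HONEST SCOPE.  (i) Pure lattice geometry: no operator, Green's function or estimate of [B4] is touched here; the file
supplies the field-side input under which the images identity (2.42) at a NON-constant field and the lineage's torus
theorem (`B4ThmTorusPairEta`) can replace Lemma 2.2 at boundary cubes — that assembly (and the removal of p17's collar
hypothesis) is NOT done here; (ii) abelian component fields (the lineage's reading of (1.2)); (iii) `N_μ ≥ 3` sites per
direction; (iv) constants are explicit polynomials in `d`, not optimised; (v) (1.7) is used in the lineage's form (at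
every box site, in every direction).  Definitions with bodies only; no `Prop`-valued fact, no `sorry`; axioms standard.
-/

namespace Literature.MathematicalPhysics.QuantumFieldTheory.Balaban1983to89.B4BoxNeumannGauge

open Literature.MathematicalPhysics.QuantumFieldTheory.Balaban1983to89.B4Reflection242 (boxDom mem_boxDom fold1 foldBox
  foldBox_apply fold1_nonneg fold1_lt fold1_of_mem fold1_reflect fold1_add_mul foldBox_mem_boxDom)
open Literature.MathematicalPhysics.QuantumFieldTheory.Balaban1983to89.B4Lower18Regular (e1 e1_apply_self e1_apply_ne)
open Literature.MathematicalPhysics.QuantumFieldTheory.Balaban1983to89.B4Lower18RegularRegion (compField compField_add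
  compField_sub)

noncomputable section

variable {d : ℕ}

/-! ## §1. Lattice differences and the one-dimensional centred average `A^ν_q` (window `2q+1`) -/

section OneDim

/-- forward difference in direction `i`: `(∂_i f)(z) = f(z + e_i) − f(z)`. [folklore] -/
def dDir (i : Fin (d + 1)) (f : (Fin (d + 1) → ℤ) → ℝ) : (Fin (d + 1) → ℤ) → ℝ := fun z => f (z + e1 i) - f z

/-- mixed second difference `(∂_i∂_ν f)(z) = f(z+e_i+e_ν) − f(z+e_i) − f(z+e_ν) + f(z)`. [folklore] -/
def d2 (i ν : Fin (d + 1)) (f : (Fin (d + 1) → ℤ) → ℝ) : (Fin (d + 1) → ℤ) → ℝ :=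
  fun z => f (z + e1 i + e1 ν) - f (z + e1 i) - f (z + e1 ν) + f z

/-- `∂_i∂_ν = ∂_ν ∘ ∂_i`. [folklore] -/
private theorem d2_eq_dDir_dDir (i ν : Fin (d + 1)) (f : (Fin (d + 1) → ℤ) → ℝ) : d2 i ν f = dDir ν (dDir i f) := by
  funext z; simp only [d2, dDir]; ring

/-- THE CENTRED ONE-DIMENSIONAL AVERAGE of half-width `q` in direction `ν`:
`(A^ν_q f)(z) = (2q+1)^{-1} Σ_{t=-q}^{q} f(z + t e_ν)`. [folklore] -/
def avgDir (ν : Fin (d + 1)) (q : ℕ) (f : (Fin (d + 1) → ℤ) → ℝ) : (Fin (d + 1) → ℤ) → ℝ :=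
  fun z => (∑ j ∈ Finset.range (2 * q + 1), f (z + ((j : ℤ) - q) • e1 ν)) / (2 * q + 1 : ℝ)

/-- `A^ν_0 = id`. [folklore] -/
private theorem avgDir_zero (ν : Fin (d + 1)) (f : (Fin (d + 1) → ℤ) → ℝ) : avgDir ν 0 f = f := by
  funext z; simp [avgDir]

/-- `A^ν_q` is additive. [folklore] -/
private theorem avgDir_add (ν : Fin (d + 1)) (q : ℕ) (f g : (Fin (d + 1) → ℤ) → ℝ) :
    avgDir ν q (f + g) = avgDir ν q f + avgDir ν q g := by
  funext z; simp only [avgDir, Pi.add_apply, Finset.sum_add_distrib, add_div]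

/-- `A^ν_q` commutes with subtraction. [folklore] -/
private theorem avgDir_sub (ν : Fin (d + 1)) (q : ℕ) (f g : (Fin (d + 1) → ℤ) → ℝ) :
    avgDir ν q (f - g) = avgDir ν q f - avgDir ν q g := by
  funext z; simp only [avgDir, Pi.sub_apply, Finset.sum_sub_distrib, sub_div]

/-- `A^ν_q` is homogeneous. [folklore] -/
private theorem avgDir_smul (ν : Fin (d + 1)) (q : ℕ) (c : ℝ) (f : (Fin (d + 1) → ℤ) → ℝ) :
    avgDir ν q (c • f) = c • avgDir ν q f := by
  funext z; simp only [avgDir, Pi.smul_apply, smul_eq_mul, ← Finset.mul_sum, mul_div_assoc]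

/-- `A^ν_q` commutes with translations. [folklore] -/
private theorem avgDir_shift (ν : Fin (d + 1)) (q : ℕ) (f : (Fin (d + 1) → ℤ) → ℝ) (v z : Fin (d + 1) → ℤ) :
    avgDir ν q (fun w => f (w + v)) z = avgDir ν q f (z + v) := by
  simp only [avgDir, add_right_comm]

/-- `A^ν_q` of a forward difference is the forward difference of `A^ν_q`. [folklore] -/
private theorem avgDir_dDir (ν : Fin (d + 1)) (q : ℕ) (i : Fin (d + 1)) (f : (Fin (d + 1) → ℤ) → ℝ) :
    avgDir ν q (dDir i f) = dDir i (avgDir ν q f) := by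
  funext z
  have h : dDir i f = (fun w => f (w + e1 i)) - f := rfl
  rw [h, avgDir_sub, Pi.sub_apply, avgDir_shift]; rfl

/-- `A^ν_q` is a sup-norm contraction. [folklore] -/
private theorem avgDir_bound (ν : Fin (d + 1)) (q : ℕ) {f : (Fin (d + 1) → ℤ) → ℝ} {B : ℝ} (hf : ∀ w, |f w| ≤ B)
    (z : Fin (d + 1) → ℤ) : |avgDir ν q f z| ≤ B := by
  have hW : (0 : ℝ) < 2 * q + 1 := by positivity
  unfold avgDir
  rw [abs_div, abs_of_pos hW, div_le_iff₀ hW]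
  calc |∑ j ∈ Finset.range (2 * q + 1), f (z + ((j : ℤ) - q) • e1 ν)|
      ≤ ∑ j ∈ Finset.range (2 * q + 1), |f (z + ((j : ℤ) - q) • e1 ν)| := Finset.abs_sum_le_sum_abs _ _
    _ ≤ ∑ _j ∈ Finset.range (2 * q + 1), B := Finset.sum_le_sum fun j _ => hf _
    _ = B * (2 * q + 1) := by simp [Finset.sum_const, Finset.card_range]; ring

/-- `A^ν_q` preserves one-step Lipschitz bounds in every direction. [folklore] -/
private theorem avgDir_lip (ν : Fin (d + 1)) (q : ℕ) {i : Fin (d + 1)} {f : (Fin (d + 1) → ℤ) → ℝ} {κ : ℝ}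
    (hf : ∀ w, |f (w + e1 i) - f w| ≤ κ) (z : Fin (d + 1) → ℤ) :
    |avgDir ν q f (z + e1 i) - avgDir ν q f z| ≤ κ := by
  have h := avgDir_bound ν q (f := dDir i f) (B := κ) hf z
  rwa [avgDir_dDir] at h

/-- an `n`-step Lipschitz bound along `e_i`. [folklore] -/
private theorem lip_nsmul {i : Fin (d + 1)} {f : (Fin (d + 1) → ℤ) → ℝ} {κ : ℝ} (hf : ∀ w, |f (w + e1 i) - f w| ≤ κ)
    (w : Fin (d + 1) → ℤ) (n : ℕ) : |f (w + (n : ℤ) • e1 i) - f w| ≤ n * κ := by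
  induction n with
  | zero => simp
  | succ n ih =>
    have e : w + ((n + 1 : ℕ) : ℤ) • e1 i = (w + (n : ℤ) • e1 i) + e1 i := by
      rw [Nat.cast_succ, add_smul, one_smul, add_assoc]
    rw [e]
    calc |f (w + (n : ℤ) • e1 i + e1 i) - f w|
        = |(f (w + (n : ℤ) • e1 i + e1 i) - f (w + (n : ℤ) • e1 i)) + (f (w + (n : ℤ) • e1 i) - f w)| := by ring_nf
      _ ≤ |f (w + (n : ℤ) • e1 i + e1 i) - f (w + (n : ℤ) • e1 i)| + |f (w + (n : ℤ) • e1 i) - f w| :=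
          abs_add_le _ _
      _ ≤ κ + n * κ := add_le_add (hf _) ih
      _ = (n + 1 : ℕ) * κ := by push_cast; ring

/-- Lipschitz bound between two points of a lattice line. [folklore] -/
private theorem lip_zsmul {i : Fin (d + 1)} {f : (Fin (d + 1) → ℤ) → ℝ} {κ : ℝ} (hf : ∀ w, |f (w + e1 i) - f w| ≤ κ)
    (w : Fin (d + 1) → ℤ) (a b : ℤ) : |f (w + a • e1 i) - f (w + b • e1 i)| ≤ (|a - b| : ℤ) * κ := by
  rcases le_total b a with hab | hab
  · obtain ⟨n, hn⟩ := Int.eq_ofNat_of_zero_le (sub_nonneg.mpr hab)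
    have e : w + a • e1 i = (w + b • e1 i) + (n : ℤ) • e1 i := by
      rw [add_assoc, ← add_smul]; congr 2; omega
    rw [e, abs_of_nonneg (sub_nonneg.mpr hab), hn]
    exact lip_nsmul hf _ n
  · obtain ⟨n, hn⟩ := Int.eq_ofNat_of_zero_le (sub_nonneg.mpr hab)
    have e : w + b • e1 i = (w + a • e1 i) + (n : ℤ) • e1 i := by
      rw [add_assoc, ← add_smul]; congr 2; omega
    rw [abs_sub_comm, e, abs_of_nonpos (sub_nonpos.mpr hab), neg_sub, hn]
    exact lip_nsmul hf _ n

/-- a one-step Lipschitz constant is non-negative. [folklore] -/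
private theorem kappa_nonneg {i : Fin (d + 1)} {f : (Fin (d + 1) → ℤ) → ℝ} {κ : ℝ} (hf : ∀ w, |f (w + e1 i) - f w| ≤ κ) :
    0 ≤ κ := (abs_nonneg _).trans (hf 0)

/-- **TELESCOPING**: `A^ν_q(∂_ν F)(z) = (F(z + (q+1)e_ν) − F(z − q e_ν))/(2q+1)`. [folklore] -/
private theorem avgDir_dDir_self (ν : Fin (d + 1)) (q : ℕ) (F : (Fin (d + 1) → ℤ) → ℝ) (z : Fin (d + 1) → ℤ) :
    avgDir ν q (dDir ν F) z = (F (z + ((q : ℤ) + 1) • e1 ν) - F (z + (-(q : ℤ)) • e1 ν)) / (2 * q + 1 : ℝ) := by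
  unfold avgDir dDir
  congr 1
  have eg : ∀ j : ℕ, z + ((j : ℤ) - q) • e1 ν + e1 ν = z + (((j + 1 : ℕ) : ℤ) - q) • e1 ν := by
    intro j
    rw [Nat.cast_succ, show ((j : ℤ) + 1 - q) = ((j : ℤ) - q) + 1 by ring, add_smul, one_smul, add_assoc]
  simp_rw [eg]
  rw [Finset.sum_range_sub (fun j : ℕ => F (z + ((j : ℤ) - q) • e1 ν))]
  have e2 : (((2 * q + 1 : ℕ) : ℤ) - q) = (q : ℤ) + 1 := by push_cast; ring
  have e0 : (((0 : ℕ) : ℤ) - q) = -(q : ℤ) := by push_cast; ring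
  rw [e2, e0]

/-- **THE SCALE-STEP IDENTITY**: `A_{q+1}f − A_q f = (f(z+(q+1)e) + f(z−(q+1)e) − 2A_q f(z))/(2q+3)`. [folklore] -/
private theorem avgDir_succ (ν : Fin (d + 1)) (q : ℕ) (f : (Fin (d + 1) → ℤ) → ℝ) (z : Fin (d + 1) → ℤ) :
    avgDir ν (q + 1) f z - avgDir ν q f z
      = (f (z + ((q : ℤ) + 1) • e1 ν) + f (z + (-((q : ℤ) + 1)) • e1 ν) - 2 * avgDir ν q f z) / (2 * q + 3 : ℝ) := by
  have hW : (2 * q + 1 : ℝ) ≠ 0 := by positivity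
  have hW' : (2 * q + 3 : ℝ) ≠ 0 := by positivity
  have hsplit : ∑ j ∈ Finset.range (2 * (q + 1) + 1), f (z + ((j : ℤ) - ((q + 1 : ℕ) : ℤ)) • e1 ν)
      = ∑ j ∈ Finset.range (2 * q + 1), f (z + ((j : ℤ) - q) • e1 ν)
        + (f (z + ((q : ℤ) + 1) • e1 ν) + f (z + (-((q : ℤ) + 1)) • e1 ν)) := by
    rw [show 2 * (q + 1) + 1 = (2 * q + 1) + 1 + 1 by ring, Finset.sum_range_succ, Finset.sum_range_succ']
    have e0 : (((0 : ℕ) : ℤ) - ((q + 1 : ℕ) : ℤ)) = -((q : ℤ) + 1) := by push_cast; ring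
    have e2 : (((2 * q + 1 + 1 : ℕ) : ℤ) - ((q + 1 : ℕ) : ℤ)) = (q : ℤ) + 1 := by push_cast; ring
    have ej : ∀ j : ℕ, (((j + 1 : ℕ) : ℤ) - ((q + 1 : ℕ) : ℤ)) = (j : ℤ) - q := by intro j; push_cast; ring
    simp only [e0, e2, ej]
    ring
  unfold avgDir
  rw [hsplit]
  push_cast
  field_simp
  ring

/-- the far right point is within `(2q+1)κ` of the average. [folklore] -/
private theorem far_sub_avgDir_le (ν : Fin (d + 1)) (q : ℕ) {f : (Fin (d + 1) → ℤ) → ℝ} {κ : ℝ}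
    (hf : ∀ w, |f (w + e1 ν) - f w| ≤ κ) (z : Fin (d + 1) → ℤ) :
    |f (z + ((q : ℤ) + 1) • e1 ν) - avgDir ν q f z| ≤ (2 * q + 1) * κ := by
  have hκ := kappa_nonneg hf
  have hW : (0 : ℝ) < 2 * q + 1 := by positivity
  have e : f (z + ((q : ℤ) + 1) • e1 ν) - avgDir ν q f z
      = (∑ j ∈ Finset.range (2 * q + 1), (f (z + ((q : ℤ) + 1) • e1 ν) - f (z + ((j : ℤ) - q) • e1 ν)))
          / (2 * q + 1 : ℝ) := by
    unfold avgDir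
    rw [Finset.sum_sub_distrib, Finset.sum_const, Finset.card_range, nsmul_eq_mul]
    field_simp
    push_cast
    ring
  rw [e, abs_div, abs_of_pos hW, div_le_iff₀ hW]
  calc |∑ j ∈ Finset.range (2 * q + 1), (f (z + ((q : ℤ) + 1) • e1 ν) - f (z + ((j : ℤ) - q) • e1 ν))|
      ≤ ∑ j ∈ Finset.range (2 * q + 1), |f (z + ((q : ℤ) + 1) • e1 ν) - f (z + ((j : ℤ) - q) • e1 ν)| :=
        Finset.abs_sum_le_sum_abs _ _
    _ ≤ ∑ _j ∈ Finset.range (2 * q + 1), (2 * q + 1) * κ := by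
        refine Finset.sum_le_sum fun j hj => ?_
        rw [Finset.mem_range] at hj
        refine (lip_zsmul hf z _ _).trans ?_
        have hb : (|((q : ℤ) + 1) - ((j : ℤ) - q)| : ℤ) ≤ 2 * q + 1 := by rw [abs_le]; omega
        have hb' : ((|((q : ℤ) + 1) - ((j : ℤ) - q)| : ℤ) : ℝ) ≤ 2 * q + 1 := by exact_mod_cast hb
        exact mul_le_mul_of_nonneg_right hb' hκ
    _ = (2 * q + 1) * κ * (2 * q + 1) := by simp [Finset.sum_const, Finset.card_range]; ring

/-- the far left point is within `(2q+1)κ` of the average. [folklore] -/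
private theorem far_sub_avgDir_le' (ν : Fin (d + 1)) (q : ℕ) {f : (Fin (d + 1) → ℤ) → ℝ} {κ : ℝ}
    (hf : ∀ w, |f (w + e1 ν) - f w| ≤ κ) (z : Fin (d + 1) → ℤ) :
    |f (z + (-((q : ℤ) + 1)) • e1 ν) - avgDir ν q f z| ≤ (2 * q + 1) * κ := by
  have hκ := kappa_nonneg hf
  have hW : (0 : ℝ) < 2 * q + 1 := by positivity
  have e : f (z + (-((q : ℤ) + 1)) • e1 ν) - avgDir ν q f z
      = (∑ j ∈ Finset.range (2 * q + 1), (f (z + (-((q : ℤ) + 1)) • e1 ν) - f (z + ((j : ℤ) - q) • e1 ν)))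
          / (2 * q + 1 : ℝ) := by
    unfold avgDir
    rw [Finset.sum_sub_distrib, Finset.sum_const, Finset.card_range, nsmul_eq_mul]
    field_simp
    push_cast
    ring
  rw [e, abs_div, abs_of_pos hW, div_le_iff₀ hW]
  calc |∑ j ∈ Finset.range (2 * q + 1), (f (z + (-((q : ℤ) + 1)) • e1 ν) - f (z + ((j : ℤ) - q) • e1 ν))|
      ≤ ∑ j ∈ Finset.range (2 * q + 1), |f (z + (-((q : ℤ) + 1)) • e1 ν) - f (z + ((j : ℤ) - q) • e1 ν)| :=
        Finset.abs_sum_le_sum_abs _ _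
    _ ≤ ∑ _j ∈ Finset.range (2 * q + 1), (2 * q + 1) * κ := by
        refine Finset.sum_le_sum fun j hj => ?_
        rw [Finset.mem_range] at hj
        refine (lip_zsmul hf z _ _).trans ?_
        have hb : (|(-((q : ℤ) + 1)) - ((j : ℤ) - q)| : ℤ) ≤ 2 * q + 1 := by rw [abs_le]; omega
        have hb' : ((|(-((q : ℤ) + 1)) - ((j : ℤ) - q)| : ℤ) : ℝ) ≤ 2 * q + 1 := by exact_mod_cast hb
        exact mul_le_mul_of_nonneg_right hb' hκ
    _ = (2 * q + 1) * κ * (2 * q + 1) := by simp [Finset.sum_const, Finset.card_range]; ring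

/-- **SCALE STEP ON A LIPSCHITZ FUNCTION**: `|A_{q+1}f − A_q f| ≤ 2κ` for `f` `κ`-Lipschitz along `e_ν`. [folklore] -/
private theorem avgDir_succ_sub_le (ν : Fin (d + 1)) (q : ℕ) {f : (Fin (d + 1) → ℤ) → ℝ} {κ : ℝ}
    (hf : ∀ w, |f (w + e1 ν) - f w| ≤ κ) (z : Fin (d + 1) → ℤ) :
    |avgDir ν (q + 1) f z - avgDir ν q f z| ≤ 2 * κ := by
  have hκ := kappa_nonneg hf
  have hW : (0 : ℝ) < 2 * q + 3 := by positivity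
  rw [avgDir_succ, abs_div, abs_of_pos hW, div_le_iff₀ hW]
  have h1 := far_sub_avgDir_le ν q hf z
  have h2 := far_sub_avgDir_le' ν q hf z
  calc |f (z + ((q : ℤ) + 1) • e1 ν) + f (z + (-((q : ℤ) + 1)) • e1 ν) - 2 * avgDir ν q f z|
      = |(f (z + ((q : ℤ) + 1) • e1 ν) - avgDir ν q f z) + (f (z + (-((q : ℤ) + 1)) • e1 ν) - avgDir ν q f z)| := by
        ring_nf
    _ ≤ (2 * q + 1) * κ + (2 * q + 1) * κ := (abs_add_le _ _).trans (add_le_add h1 h2)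
    _ ≤ 2 * κ * (2 * q + 3) := by nlinarith

/-- **SCALE STEP ON A BOUNDED FUNCTION**: `|A_{q+1}H − A_q H| ≤ 4B/(2q+3)` for `|H| ≤ B`. [folklore] -/
private theorem avgDir_succ_sub_le_of_bound (ν : Fin (d + 1)) (q : ℕ) {H : (Fin (d + 1) → ℤ) → ℝ} {B : ℝ}
    (hH : ∀ w, |H w| ≤ B) (z : Fin (d + 1) → ℤ) :
    |avgDir ν (q + 1) H z - avgDir ν q H z| ≤ 4 * B / (2 * q + 3) := by
  have hW : (0 : ℝ) < 2 * q + 3 := by positivity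
  rw [avgDir_succ, abs_div, abs_of_pos hW, div_le_div_iff_of_pos_right hW]
  have h3 := avgDir_bound ν q hH z
  calc |H (z + ((q : ℤ) + 1) • e1 ν) + H (z + (-((q : ℤ) + 1)) • e1 ν) - 2 * avgDir ν q H z|
      ≤ |H (z + ((q : ℤ) + 1) • e1 ν) + H (z + (-((q : ℤ) + 1)) • e1 ν)| + |2 * avgDir ν q H z| := abs_sub _ _
    _ ≤ (|H (z + ((q : ℤ) + 1) • e1 ν)| + |H (z + (-((q : ℤ) + 1)) • e1 ν)|) + 2 * |avgDir ν q H z| := by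
        rw [abs_mul, abs_two]; exact add_le_add (abs_add_le _ _) le_rfl
    _ ≤ (B + B) + 2 * B := by gcongr <;> exact hH _
    _ = 4 * B := by ring

/-- **SECOND SCALE-DIFFERENCE ON A LIPSCHITZ FUNCTION**: `(q+1)|A_{q+2}f − 2A_{q+1}f + A_q f| ≤ 5κ`. [folklore] -/
private theorem avgDir_scale_d2_le (ν : Fin (d + 1)) (q : ℕ) {f : (Fin (d + 1) → ℤ) → ℝ} {κ : ℝ}
    (hf : ∀ w, |f (w + e1 ν) - f w| ≤ κ) (z : Fin (d + 1) → ℤ) :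
    ((q : ℝ) + 1) * |avgDir ν (q + 2) f z - 2 * avgDir ν (q + 1) f z + avgDir ν q f z| ≤ 5 * κ := by
  have hκ := kappa_nonneg hf
  set D0 := f (z + ((q : ℤ) + 1) • e1 ν) + f (z + (-((q : ℤ) + 1)) • e1 ν) - 2 * avgDir ν q f z with hD0
  set D1 := f (z + ((q : ℤ) + 2) • e1 ν) + f (z + (-((q : ℤ) + 2)) • e1 ν) - 2 * avgDir ν (q + 1) f z with hD1
  have hW3 : (0 : ℝ) < 2 * q + 3 := by positivity
  have hW5 : (0 : ℝ) < 2 * q + 5 := by positivity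
  have s0 : avgDir ν (q + 1) f z - avgDir ν q f z = D0 / (2 * q + 3) := avgDir_succ ν q f z
  have s1 : avgDir ν (q + 2) f z - avgDir ν (q + 1) f z = D1 / (2 * q + 5) := by
    have h := avgDir_succ ν (q + 1) f z
    rw [h, hD1]; push_cast; ring_nf
  -- size of D0
  have hD0le : |D0| ≤ 2 * (2 * q + 1) * κ := by
    have h1 := far_sub_avgDir_le ν q hf z
    have h2 := far_sub_avgDir_le' ν q hf z
    calc |D0| = |(f (z + ((q : ℤ) + 1) • e1 ν) - avgDir ν q f z)
                  + (f (z + (-((q : ℤ) + 1)) • e1 ν) - avgDir ν q f z)| := by rw [hD0]; ring_nf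
      _ ≤ (2 * q + 1) * κ + (2 * q + 1) * κ := (abs_add_le _ _).trans (add_le_add h1 h2)
      _ = 2 * (2 * q + 1) * κ := by ring
  -- size of D1 - D0
  have hstep : |D1 - D0| ≤ 6 * κ := by
    have ea : z + ((q : ℤ) + 2) • e1 ν = (z + ((q : ℤ) + 1) • e1 ν) + e1 ν := by
      rw [add_assoc, ← add_one_zsmul]; congr 2
    have eb : z + (-((q : ℤ) + 1)) • e1 ν = (z + (-((q : ℤ) + 2)) • e1 ν) + e1 ν := by
      rw [add_assoc, ← add_one_zsmul]; congr 2
    have ha := hf (z + ((q : ℤ) + 1) • e1 ν)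
    have hb := hf (z + (-((q : ℤ) + 2)) • e1 ν)
    rw [← ea] at ha
    rw [← eb] at hb
    have hc := avgDir_succ_sub_le ν q hf z
    have e : D1 - D0 = (f (z + ((q : ℤ) + 2) • e1 ν) - f (z + ((q : ℤ) + 1) • e1 ν))
        - (f (z + (-((q : ℤ) + 1)) • e1 ν) - f (z + (-((q : ℤ) + 2)) • e1 ν))
        - 2 * (avgDir ν (q + 1) f z - avgDir ν q f z) := by rw [hD1, hD0]; ring
    rw [e]
    calc |f (z + ((q : ℤ) + 2) • e1 ν) - f (z + ((q : ℤ) + 1) • e1 ν)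
          - (f (z + (-((q : ℤ) + 1)) • e1 ν) - f (z + (-((q : ℤ) + 2)) • e1 ν))
          - 2 * (avgDir ν (q + 1) f z - avgDir ν q f z)|
        ≤ |f (z + ((q : ℤ) + 2) • e1 ν) - f (z + ((q : ℤ) + 1) • e1 ν)
            - (f (z + (-((q : ℤ) + 1)) • e1 ν) - f (z + (-((q : ℤ) + 2)) • e1 ν))|
          + |2 * (avgDir ν (q + 1) f z - avgDir ν q f z)| := abs_sub _ _
      _ ≤ (|f (z + ((q : ℤ) + 2) • e1 ν) - f (z + ((q : ℤ) + 1) • e1 ν)|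
            + |f (z + (-((q : ℤ) + 1)) • e1 ν) - f (z + (-((q : ℤ) + 2)) • e1 ν)|)
          + 2 * |avgDir ν (q + 1) f z - avgDir ν q f z| := by
          rw [abs_mul, abs_two]; exact add_le_add (abs_sub _ _) le_rfl
      _ ≤ (κ + κ) + 2 * (2 * κ) := by gcongr
      _ = 6 * κ := by ring
  -- conclusion
  have key : avgDir ν (q + 2) f z - 2 * avgDir ν (q + 1) f z + avgDir ν q f z
      = ((D1 - D0) * (2 * q + 3) - 2 * D0) / ((2 * q + 3) * (2 * q + 5)) := by
    have e : avgDir ν (q + 2) f z - 2 * avgDir ν (q + 1) f z + avgDir ν q f z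
        = (avgDir ν (q + 2) f z - avgDir ν (q + 1) f z) - (avgDir ν (q + 1) f z - avgDir ν q f z) := by ring
    rw [e, s0, s1]
    field_simp
    ring
  rw [key, abs_div, abs_of_pos (mul_pos hW3 hW5), ← mul_div_assoc, div_le_iff₀ (mul_pos hW3 hW5)]
  have hnum : |(D1 - D0) * (2 * q + 3) - 2 * D0| ≤ 6 * κ * (2 * q + 3) + 2 * (2 * (2 * q + 1) * κ) := by
    calc |(D1 - D0) * (2 * q + 3) - 2 * D0| ≤ |(D1 - D0) * (2 * q + 3)| + |2 * D0| := abs_sub _ _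
      _ = |D1 - D0| * (2 * q + 3) + 2 * |D0| := by
          rw [abs_mul, abs_of_pos hW3, abs_mul, abs_two]
      _ ≤ 6 * κ * (2 * q + 3) + 2 * (2 * (2 * q + 1) * κ) := by gcongr
  have hq : (0 : ℝ) ≤ q := Nat.cast_nonneg q
  calc ((q : ℝ) + 1) * |(D1 - D0) * (2 * q + 3) - 2 * D0|
      ≤ ((q : ℝ) + 1) * (6 * κ * (2 * q + 3) + 2 * (2 * (2 * q + 1) * κ)) := by gcongr
    _ ≤ 5 * κ * ((2 * q + 3) * (2 * q + 5)) := by nlinarith [mul_nonneg hκ hq, mul_nonneg (mul_nonneg hκ hq) hq]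

/-- the coordinate reflection `z ↦ (z with z_μ ↦ a − z_μ)` (mirrors of the box at the half-integers). [folklore] -/
def reflC (μ : Fin (d + 1)) (a : ℤ) (z : Fin (d + 1) → ℤ) : Fin (d + 1) → ℤ := Function.update z μ (a - z μ)

/-- a coordinate reflection is an involution. [folklore] -/
private theorem reflC_reflC (μ : Fin (d + 1)) (a : ℤ) (z : Fin (d + 1) → ℤ) : reflC μ a (reflC μ a z) = z := by
  funext k
  by_cases hk : k = μ
  · subst hk; simp [reflC]
  · simp [reflC, hk]

/-- a coordinate reflection reverses lattice steps in its own direction and preserves the others. [folklore] -/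
private theorem reflC_add_zsmul (μ : Fin (d + 1)) (a : ℤ) (z : Fin (d + 1) → ℤ) (t : ℤ) (ν : Fin (d + 1)) :
    reflC μ a (z + t • e1 ν) = reflC μ a z + (if ν = μ then -t else t) • e1 ν := by
  funext k
  by_cases hk : k = μ
  · subst hk
    by_cases hν : ν = k
    · subst hν; simp [reflC]; ring
    · simp [reflC, hν, e1_apply_ne (Ne.symm hν)]
  · by_cases hν : ν = μ
    · subst hν; simp [reflC, hk, e1_apply_ne hk]
    · simp [reflC, hk, hν]

/-- **`A^ν_q` COMMUTES WITH THE COORDINATE REFLECTIONS** (symmetric window). [folklore] -/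
private theorem avgDir_reflC (ν : Fin (d + 1)) (q : ℕ) (μ : Fin (d + 1)) (a : ℤ) (f : (Fin (d + 1) → ℤ) → ℝ)
    (z : Fin (d + 1) → ℤ) : avgDir ν q (fun w => f (reflC μ a w)) z = avgDir ν q f (reflC μ a z) := by
  unfold avgDir
  congr 1
  simp only [reflC_add_zsmul]
  by_cases hν : ν = μ
  · simp only [hν, if_true]
    rw [← Finset.sum_range_reflect]
    refine Finset.sum_congr rfl fun j hj => ?_
    rw [Finset.mem_range] at hj
    congr 2
    have : ((2 * q + 1 - 1 - j : ℕ) : ℤ) = 2 * q - j := by omega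
    rw [this]; ring
  · simp only [hν, if_false]

end OneDim

/-! ## §2. The cube average `S_q = Π_ν A^ν_q`, the weighted kernels `ρ_r = r·S_{r−1}` and `P_m = ρ_{m+1} − ρ_m` -/

section Smooth

/-- iterated one-dimensional averaging over a list of directions. [folklore] -/
def smoothL (L : List (Fin (d + 1))) (q : ℕ) (f : (Fin (d + 1) → ℤ) → ℝ) : (Fin (d + 1) → ℤ) → ℝ :=
  L.foldr (fun ν g => avgDir ν q g) f

/-- unfolding on the empty list. [folklore] -/
@[simp] private theorem smoothL_nil (q : ℕ) (f : (Fin (d + 1) → ℤ) → ℝ) : smoothL [] q f = f := rfl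

/-- unfolding on a cons. [folklore] -/
@[simp] private theorem smoothL_cons (ν : Fin (d + 1)) (L : List (Fin (d + 1))) (q : ℕ) (f : (Fin (d + 1) → ℤ) → ℝ) :
    smoothL (ν :: L) q f = avgDir ν q (smoothL L q f) := rfl

/-- **THE CUBE AVERAGE** of half-width `q`: `S_q = A^0_q A^1_q ⋯ A^d_q` (uniform average over `z + [−q,q]^{d+1}`).
[folklore] -/
def smooth (q : ℕ) (f : (Fin (d + 1) → ℤ) → ℝ) : (Fin (d + 1) → ℤ) → ℝ := smoothL (List.finRange (d + 1)) q f

/-- `S_0 = id` (list form). [folklore] -/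
private theorem smoothL_zero (L : List (Fin (d + 1))) (f : (Fin (d + 1) → ℤ) → ℝ) : smoothL L 0 f = f := by
  induction L with
  | nil => rfl
  | cons ν L ih => rw [smoothL_cons, ih, avgDir_zero]

/-- `smoothL` commutes with subtraction. [folklore] -/
private theorem smoothL_sub (L : List (Fin (d + 1))) (q : ℕ) (f g : (Fin (d + 1) → ℤ) → ℝ) :
    smoothL L q (f - g) = smoothL L q f - smoothL L q g := by
  induction L with
  | nil => rfl
  | cons ν L ih => rw [smoothL_cons, ih, avgDir_sub]; rfl

/-- `smoothL` is additive. [folklore] -/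
private theorem smoothL_add (L : List (Fin (d + 1))) (q : ℕ) (f g : (Fin (d + 1) → ℤ) → ℝ) :
    smoothL L q (f + g) = smoothL L q f + smoothL L q g := by
  induction L with
  | nil => rfl
  | cons ν L ih => rw [smoothL_cons, ih, avgDir_add]; rfl

/-- `smoothL` is homogeneous. [folklore] -/
private theorem smoothL_smul (L : List (Fin (d + 1))) (q : ℕ) (c : ℝ) (f : (Fin (d + 1) → ℤ) → ℝ) :
    smoothL L q (c • f) = c • smoothL L q f := by
  induction L with
  | nil => rfl
  | cons ν L ih => rw [smoothL_cons, ih, avgDir_smul]; rfl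

/-- `smoothL` commutes with translations. [folklore] -/
private theorem smoothL_shift (L : List (Fin (d + 1))) (q : ℕ) (f : (Fin (d + 1) → ℤ) → ℝ) (v : Fin (d + 1) → ℤ) :
    smoothL L q (fun w => f (w + v)) = fun z => smoothL L q f (z + v) := by
  induction L with
  | nil => rfl
  | cons ν L ih =>
    rw [smoothL_cons, smoothL_cons, ih]
    funext z
    exact avgDir_shift ν q _ v z

/-- `smoothL` commutes with forward differences. [folklore] -/
private theorem smoothL_dDir (L : List (Fin (d + 1))) (q : ℕ) (i : Fin (d + 1)) (f : (Fin (d + 1) → ℤ) → ℝ) :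
    smoothL L q (dDir i f) = dDir i (smoothL L q f) := by
  have h : dDir i f = (fun w => f (w + e1 i)) - f := rfl
  rw [h, smoothL_sub, smoothL_shift]; rfl

/-- `smoothL` commutes with mixed second differences. [folklore] -/
private theorem smoothL_d2 (L : List (Fin (d + 1))) (q : ℕ) (i ν : Fin (d + 1)) (f : (Fin (d + 1) → ℤ) → ℝ) :
    smoothL L q (d2 i ν f) = d2 i ν (smoothL L q f) := by
  rw [d2_eq_dDir_dDir, smoothL_dDir, smoothL_dDir, ← d2_eq_dDir_dDir]

/-- `smoothL` commutes with the coordinate reflections. [folklore] -/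
private theorem smoothL_reflC (L : List (Fin (d + 1))) (q : ℕ) (μ : Fin (d + 1)) (a : ℤ) (f : (Fin (d + 1) → ℤ) → ℝ) :
    smoothL L q (fun w => f (reflC μ a w)) = fun z => smoothL L q f (reflC μ a z) := by
  induction L with
  | nil => rfl
  | cons ν L ih =>
    rw [smoothL_cons, smoothL_cons, ih]
    funext z
    exact avgDir_reflC ν q μ a _ z

/-- `smoothL` is a sup-norm contraction. [folklore] -/
private theorem smoothL_bound (L : List (Fin (d + 1))) (q : ℕ) {f : (Fin (d + 1) → ℤ) → ℝ} {B : ℝ} (hf : ∀ w, |f w| ≤ B)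
    (z : Fin (d + 1) → ℤ) : |smoothL L q f z| ≤ B := by
  induction L generalizing z with
  | nil => exact hf z
  | cons ν L ih => rw [smoothL_cons]; exact avgDir_bound ν q ih z

/-- `smoothL` preserves one-step Lipschitz bounds. [folklore] -/
private theorem smoothL_lip (L : List (Fin (d + 1))) (q : ℕ) {i : Fin (d + 1)} {f : (Fin (d + 1) → ℤ) → ℝ} {κ : ℝ}
    (hf : ∀ w, |f (w + e1 i) - f w| ≤ κ) (z : Fin (d + 1) → ℤ) :
    |smoothL L q f (z + e1 i) - smoothL L q f z| ≤ κ := by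
  have h := smoothL_bound L q (f := dDir i f) (B := κ) hf z
  rwa [smoothL_dDir] at h

/-- **SCALE STEP OF THE CUBE AVERAGE ON A LIPSCHITZ FUNCTION**: `|S_{q+1}f − S_q f| ≤ 2|L|κ`. [folklore] -/
private theorem smoothL_succ_sub_le (L : List (Fin (d + 1))) (q : ℕ) {f : (Fin (d + 1) → ℤ) → ℝ} {κ : ℝ}
    (hf : ∀ i w, |f (w + e1 i) - f w| ≤ κ) (z : Fin (d + 1) → ℤ) :
    |smoothL L (q + 1) f z - smoothL L q f z| ≤ L.length * (2 * κ) := by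
  induction L generalizing z with
  | nil => simp
  | cons ν L ih =>
    rw [smoothL_cons, smoothL_cons, List.length_cons, Nat.cast_succ]
    have h1 : |avgDir ν (q + 1) (smoothL L (q + 1) f) z - avgDir ν (q + 1) (smoothL L q f) z|
        ≤ L.length * (2 * κ) := by
      rw [← Pi.sub_apply (avgDir ν (q + 1) _), ← avgDir_sub]
      exact avgDir_bound ν (q + 1) (f := smoothL L (q + 1) f - smoothL L q f) (fun w => ih w) z
    have h2 : |avgDir ν (q + 1) (smoothL L q f) z - avgDir ν q (smoothL L q f) z| ≤ 2 * κ :=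
      avgDir_succ_sub_le ν q (fun w => smoothL_lip L q (hf ν) w) z
    calc |avgDir ν (q + 1) (smoothL L (q + 1) f) z - avgDir ν q (smoothL L q f) z|
        = |(avgDir ν (q + 1) (smoothL L (q + 1) f) z - avgDir ν (q + 1) (smoothL L q f) z)
            + (avgDir ν (q + 1) (smoothL L q f) z - avgDir ν q (smoothL L q f) z)| := by ring_nf
      _ ≤ L.length * (2 * κ) + 2 * κ := (abs_add_le _ _).trans (add_le_add h1 h2)
      _ = (L.length + 1) * (2 * κ) := by ring

/-- **SCALE STEP OF THE CUBE AVERAGE ON A BOUNDED FUNCTION**: `|S_{q+1}H − S_q H| ≤ |L|·4B/(2q+3)`. [folklore] -/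
private theorem smoothL_succ_sub_le_of_bound (L : List (Fin (d + 1))) (q : ℕ) {H : (Fin (d + 1) → ℤ) → ℝ} {B : ℝ}
    (hH : ∀ w, |H w| ≤ B) (z : Fin (d + 1) → ℤ) :
    |smoothL L (q + 1) H z - smoothL L q H z| ≤ L.length * (4 * B / (2 * q + 3)) := by
  induction L generalizing z with
  | nil => simp
  | cons ν L ih =>
    rw [smoothL_cons, smoothL_cons, List.length_cons, Nat.cast_succ]
    have h1 : |avgDir ν (q + 1) (smoothL L (q + 1) H) z - avgDir ν (q + 1) (smoothL L q H) z|
        ≤ L.length * (4 * B / (2 * q + 3)) := by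
      rw [← Pi.sub_apply (avgDir ν (q + 1) _), ← avgDir_sub]
      exact avgDir_bound ν (q + 1) (f := smoothL L (q + 1) H - smoothL L q H) (fun w => ih w) z
    have h2 : |avgDir ν (q + 1) (smoothL L q H) z - avgDir ν q (smoothL L q H) z| ≤ 4 * B / (2 * q + 3) :=
      avgDir_succ_sub_le_of_bound ν q (fun w => smoothL_bound L q hH w) z
    calc |avgDir ν (q + 1) (smoothL L (q + 1) H) z - avgDir ν q (smoothL L q H) z|
        = |(avgDir ν (q + 1) (smoothL L (q + 1) H) z - avgDir ν (q + 1) (smoothL L q H) z)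
            + (avgDir ν (q + 1) (smoothL L q H) z - avgDir ν q (smoothL L q H) z)| := by ring_nf
      _ ≤ L.length * (4 * B / (2 * q + 3)) + 4 * B / (2 * q + 3) := (abs_add_le _ _).trans (add_le_add h1 h2)
      _ = (L.length + 1) * (4 * B / (2 * q + 3)) := by ring

/-- pointwise linearity of `A^ν_q` (combination used in the discrete Leibniz rule). [folklore] -/
private theorem avgDir_comb (ν : Fin (d + 1)) (q : ℕ) (g2 g1 g0 : (Fin (d + 1) → ℤ) → ℝ) (z : Fin (d + 1) → ℤ) :
    avgDir ν q (fun w => g2 w - 2 * g1 w + g0 w) z = avgDir ν q g2 z - 2 * avgDir ν q g1 z + avgDir ν q g0 z := by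
  simp only [avgDir, Finset.sum_add_distrib, Finset.sum_sub_distrib, ← Finset.mul_sum]
  field_simp

/-- **SECOND SCALE-DIFFERENCE OF THE CUBE AVERAGE ON A LIPSCHITZ FUNCTION** (discrete Leibniz rule over the list
of directions + the one-dimensional estimates): `(q+1)|S_{q+2}f − 2S_{q+1}f + S_q f| ≤ (4|L|² + |L|)κ`. [folklore] -/
private theorem smoothL_scale_d2_le (L : List (Fin (d + 1))) (q : ℕ) {f : (Fin (d + 1) → ℤ) → ℝ} {κ : ℝ}
    (hf : ∀ i w, |f (w + e1 i) - f w| ≤ κ) (z : Fin (d + 1) → ℤ) :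
    ((q : ℝ) + 1) * |smoothL L (q + 2) f z - 2 * smoothL L (q + 1) f z + smoothL L q f z|
      ≤ (4 * (L.length : ℝ) ^ 2 + L.length) * κ := by
  have hκ : 0 ≤ κ := kappa_nonneg (hf 0)
  induction L generalizing z with
  | nil =>
    have e : f z - 2 * f z + f z = 0 := by ring
    simp [e]
  | cons ν L ih =>
    simp only [smoothL_cons, List.length_cons, Nat.cast_succ]
    set g2 := smoothL L (q + 2) f
    set g1 := smoothL L (q + 1) f
    set g0 := smoothL L q f
    have hq1 : (0 : ℝ) < (q : ℝ) + 1 := by positivity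
    -- discrete Leibniz rule
    have leib : avgDir ν (q + 2) g2 z - 2 * avgDir ν (q + 1) g1 z + avgDir ν q g0 z
        = avgDir ν (q + 2) (fun w => g2 w - 2 * g1 w + g0 w) z
          + (avgDir ν (q + 2) g0 z - 2 * avgDir ν (q + 1) g0 z + avgDir ν q g0 z)
          + 2 * (avgDir ν (q + 2) (g1 - g0) z - avgDir ν (q + 1) (g1 - g0) z) := by
      rw [avgDir_comb, avgDir_sub, avgDir_sub, Pi.sub_apply, Pi.sub_apply]; ring
    -- term 1: contraction on the inner second scale-difference
    have t1 : ((q : ℝ) + 1) * |avgDir ν (q + 2) (fun w => g2 w - 2 * g1 w + g0 w) z|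
        ≤ (4 * (L.length : ℝ) ^ 2 + L.length) * κ := by
      have hb : ∀ w, |g2 w - 2 * g1 w + g0 w| ≤ (4 * (L.length : ℝ) ^ 2 + L.length) * κ / ((q : ℝ) + 1) := by
        intro w; rw [le_div_iff₀ hq1, mul_comm]; exact ih w
      have h := avgDir_bound ν (q + 2) hb z
      rwa [le_div_iff₀ hq1, mul_comm] at h
    -- term 2: the one-dimensional second scale-difference on the Lipschitz function `g0`
    have t2 : ((q : ℝ) + 1) * |avgDir ν (q + 2) g0 z - 2 * avgDir ν (q + 1) g0 z + avgDir ν q g0 z| ≤ 5 * κ :=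
      avgDir_scale_d2_le ν q (fun w => smoothL_lip L q (hf ν) w) z
    -- term 3: bounded-function scale step on `g1 − g0`
    have t3 : ((q : ℝ) + 1) * |2 * (avgDir ν (q + 2) (g1 - g0) z - avgDir ν (q + 1) (g1 - g0) z)|
        ≤ 8 * L.length * κ := by
      have hb : ∀ w, |(g1 - g0) w| ≤ L.length * (2 * κ) := fun w => smoothL_succ_sub_le L q hf w
      have h := avgDir_succ_sub_le_of_bound ν (q + 1) hb z
      rw [abs_mul, abs_two]
      have hW : (0 : ℝ) < 2 * ((q + 1 : ℕ) : ℝ) + 3 := by positivity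
      rw [le_div_iff₀ hW] at h
      push_cast at h
      nlinarith [abs_nonneg (avgDir ν (q + 2) (g1 - g0) z - avgDir ν (q + 1) (g1 - g0) z),
        mul_nonneg hκ (Nat.cast_nonneg q), Nat.cast_nonneg (α := ℝ) L.length,
        mul_nonneg (mul_nonneg hκ (Nat.cast_nonneg q)) (Nat.cast_nonneg (α := ℝ) L.length)]
    rw [leib]
    calc ((q : ℝ) + 1) * |avgDir ν (q + 2) (fun w => g2 w - 2 * g1 w + g0 w) z
            + (avgDir ν (q + 2) g0 z - 2 * avgDir ν (q + 1) g0 z + avgDir ν q g0 z)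
            + 2 * (avgDir ν (q + 2) (g1 - g0) z - avgDir ν (q + 1) (g1 - g0) z)|
        ≤ ((q : ℝ) + 1) * (|avgDir ν (q + 2) (fun w => g2 w - 2 * g1 w + g0 w) z|
            + |avgDir ν (q + 2) g0 z - 2 * avgDir ν (q + 1) g0 z + avgDir ν q g0 z|
            + |2 * (avgDir ν (q + 2) (g1 - g0) z - avgDir ν (q + 1) (g1 - g0) z)|) := by
          gcongr
          exact (abs_add_le _ _).trans (add_le_add (abs_add_le _ _) le_rfl)
      _ ≤ (4 * (L.length : ℝ) ^ 2 + L.length) * κ + 5 * κ + 8 * L.length * κ := by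
          rw [mul_add, mul_add]; exact add_le_add (add_le_add t1 t2) t3
      _ = (4 * ((L.length : ℝ) + 1) ^ 2 + ((L.length : ℝ) + 1)) * κ := by ring

/-- **AVERAGING A DIFFERENCE ALONG A DIRECTION OF THE LIST**: `|S_q(∂_ν F)| ≤ 2B/(2q+1)` for `|F| ≤ B`, `ν ∈ L`
(telescoping inside the window of `A^ν_q`). [folklore] -/
private theorem smoothL_dDir_le (L : List (Fin (d + 1))) (q : ℕ) {ν : Fin (d + 1)} (hν : ν ∈ L)
    {F : (Fin (d + 1) → ℤ) → ℝ} {B : ℝ} (hF : ∀ w, |F w| ≤ B) (z : Fin (d + 1) → ℤ) :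
    |smoothL L q (dDir ν F) z| ≤ 2 * B / (2 * q + 1) := by
  induction L generalizing z with
  | nil => simp at hν
  | cons ν' L ih =>
    rw [smoothL_cons]
    by_cases h : ν' = ν
    · subst h
      rw [smoothL_dDir, avgDir_dDir_self]
      have hW : (0 : ℝ) < 2 * q + 1 := by positivity
      rw [abs_div, abs_of_pos hW, div_le_div_iff_of_pos_right hW]
      have h1 := smoothL_bound L q hF (z + ((q : ℤ) + 1) • e1 ν')
      have h2 := smoothL_bound L q hF (z + (-(q : ℤ)) • e1 ν')
      calc |smoothL L q F (z + ((q : ℤ) + 1) • e1 ν') - smoothL L q F (z + (-(q : ℤ)) • e1 ν')|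
          ≤ |smoothL L q F (z + ((q : ℤ) + 1) • e1 ν')| + |smoothL L q F (z + (-(q : ℤ)) • e1 ν')| := abs_sub _ _
        _ ≤ B + B := add_le_add h1 h2
        _ = 2 * B := by ring
    · have hν' : ν ∈ L := by
        rcases List.mem_cons.mp hν with h' | h'
        · exact absurd h'.symm h
        · exact h'
      exact avgDir_bound ν' q (fun w => ih hν' w) z

/-- **THE WEIGHTED KERNELS** `ρ_r = r·S_{r−1}` (`ρ_0 = 0`, `ρ_1 = id`): `r` times the uniform average over the cube of
half-width `r − 1`. [folklore] -/
def rho (r : ℕ) (f : (Fin (d + 1) → ℤ) → ℝ) : (Fin (d + 1) → ℤ) → ℝ := fun z => (r : ℝ) * smooth (r - 1) f z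

/-- **THE KERNELS `P_m = ρ_{m+1} − ρ_m`** (signed, total mass one, `P_0 = id`). [folklore] -/
def pk (m : ℕ) (f : (Fin (d + 1) → ℤ) → ℝ) : (Fin (d + 1) → ℤ) → ℝ := fun z => rho (m + 1) f z - rho m f z

/-- `ρ_0 = 0`. [folklore] -/
@[simp] private theorem rho_zero (f : (Fin (d + 1) → ℤ) → ℝ) (z : Fin (d + 1) → ℤ) : rho 0 f z = 0 := by simp [rho]

/-- `ρ_1 = id`. [folklore] -/
@[simp] private theorem rho_one (f : (Fin (d + 1) → ℤ) → ℝ) (z : Fin (d + 1) → ℤ) : rho 1 f z = f z := by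
  simp [rho, smooth, smoothL_zero]

/-- `P_0 = id`. [folklore] -/
@[simp] private theorem pk_zero (f : (Fin (d + 1) → ℤ) → ℝ) (z : Fin (d + 1) → ℤ) : pk 0 f z = f z := by simp [pk]

/-- `ρ_r` commutes with subtraction. [folklore] -/
private theorem rho_sub (r : ℕ) (f g : (Fin (d + 1) → ℤ) → ℝ) (z : Fin (d + 1) → ℤ) :
    rho r (f - g) z = rho r f z - rho r g z := by
  simp only [rho, smooth, smoothL_sub, Pi.sub_apply, mul_sub]

/-- `ρ_r` is additive. [folklore] -/
private theorem rho_add (r : ℕ) (f g : (Fin (d + 1) → ℤ) → ℝ) (z : Fin (d + 1) → ℤ) :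
    rho r (f + g) z = rho r f z + rho r g z := by
  simp only [rho, smooth, smoothL_add, Pi.add_apply, mul_add]

/-- `ρ_r` is homogeneous. [folklore] -/
private theorem rho_smul (r : ℕ) (c : ℝ) (f : (Fin (d + 1) → ℤ) → ℝ) (z : Fin (d + 1) → ℤ) :
    rho r (c • f) z = c * rho r f z := by
  simp only [rho, smooth, smoothL_smul, Pi.smul_apply, smul_eq_mul]; ring

/-- `P_m` commutes with subtraction. [folklore] -/
private theorem pk_sub (m : ℕ) (f g : (Fin (d + 1) → ℤ) → ℝ) (z : Fin (d + 1) → ℤ) :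
    pk m (f - g) z = pk m f z - pk m g z := by
  simp only [pk, rho_sub]; ring

/-- `P_m` is additive. [folklore] -/
private theorem pk_add (m : ℕ) (f g : (Fin (d + 1) → ℤ) → ℝ) (z : Fin (d + 1) → ℤ) :
    pk m (f + g) z = pk m f z + pk m g z := by
  simp only [pk, rho_add]; ring

/-- `ρ_r` commutes with translations. [folklore] -/
private theorem rho_shift (r : ℕ) (f : (Fin (d + 1) → ℤ) → ℝ) (v z : Fin (d + 1) → ℤ) :
    rho r (fun w => f (w + v)) z = rho r f (z + v) := by
  simp only [rho, smooth, smoothL_shift]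

/-- `P_m` commutes with translations. [folklore] -/
private theorem pk_shift (m : ℕ) (f : (Fin (d + 1) → ℤ) → ℝ) (v z : Fin (d + 1) → ℤ) :
    pk m (fun w => f (w + v)) z = pk m f (z + v) := by
  simp only [pk, rho_shift]

/-- `ρ_r` commutes with the coordinate reflections. [folklore] -/
private theorem rho_reflC (r : ℕ) (μ : Fin (d + 1)) (a : ℤ) (f : (Fin (d + 1) → ℤ) → ℝ) (z : Fin (d + 1) → ℤ) :
    rho r (fun w => f (reflC μ a w)) z = rho r f (reflC μ a z) := by
  simp only [rho, smooth, smoothL_reflC]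

/-- `ρ_r` commutes with mixed second differences. [folklore] -/
private theorem d2_rho (r : ℕ) (i ν : Fin (d + 1)) (f : (Fin (d + 1) → ℤ) → ℝ) (z : Fin (d + 1) → ℤ) :
    d2 i ν (rho r f) z = rho r (d2 i ν f) z := by
  simp only [rho, smooth, smoothL_d2, d2]; ring

/-- `ρ_r` commutes with forward differences. [folklore] -/
private theorem dDir_rho (r : ℕ) (i : Fin (d + 1)) (f : (Fin (d + 1) → ℤ) → ℝ) (z : Fin (d + 1) → ℤ) :
    dDir i (rho r f) z = rho r (dDir i f) z := by
  simp only [rho, smooth, smoothL_dDir, dDir]; ring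

/-- `P_m` commutes with forward differences. [folklore] -/
private theorem dDir_pk (m : ℕ) (i : Fin (d + 1)) (f : (Fin (d + 1) → ℤ) → ℝ) (z : Fin (d + 1) → ℤ) :
    dDir i (pk m f) z = pk m (dDir i f) z := by
  simp only [pk, ← dDir_rho, dDir]; ring

/-- the mixed second difference is symmetric in its two directions. [folklore] -/
private theorem d2_comm (i ν : Fin (d + 1)) (f : (Fin (d + 1) → ℤ) → ℝ) : d2 i ν f = d2 ν i f := by
  funext z; simp only [d2, add_right_comm]; ring

/-- **THE KEY KERNEL ESTIMATE**: `|∂_i∂_ν(ρ_r F)| ≤ 2κ` whenever the one-step differences of `F` along `e_i` are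
bounded by `κ` (the window of `A^ν_{r−1}` telescopes `∂_ν`, gaining the factor `(2r−1)^{-1}` against the weight `r`).
[folklore] -/
private theorem d2_rho_le (r : ℕ) {i : Fin (d + 1)} (ν : Fin (d + 1)) {F : (Fin (d + 1) → ℤ) → ℝ} {κ : ℝ}
    (hF : ∀ w, |F (w + e1 i) - F w| ≤ κ) (z : Fin (d + 1) → ℤ) : |d2 i ν (rho r F) z| ≤ 2 * κ := by
  have hκ := kappa_nonneg hF
  cases r with
  | zero => simp [d2, rho]; linarith
  | succ q =>
    rw [d2_rho]
    simp only [rho, smooth, Nat.add_sub_cancel, d2_eq_dDir_dDir]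
    have h := smoothL_dDir_le (List.finRange (d + 1)) q (List.mem_finRange ν) (F := dDir i F) (B := κ) hF z
    rw [abs_mul, Nat.cast_succ, abs_of_pos (by positivity : (0 : ℝ) < q + 1)]
    have hW : (0 : ℝ) < 2 * q + 1 := by positivity
    rw [le_div_iff₀ hW] at h
    nlinarith [abs_nonneg (smoothL (List.finRange (d + 1)) q (dDir ν (dDir i F)) z), mul_nonneg hκ (Nat.cast_nonneg q)]

/-- **TOTAL-VARIATION BOUND OF `P_m`**: `|P_m F| ≤ (2(d+1)+1)·B` for `|F| ≤ B`. [folklore] -/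
private theorem pk_bound (m : ℕ) {F : (Fin (d + 1) → ℤ) → ℝ} {B : ℝ} (hF : ∀ w, |F w| ≤ B) (z : Fin (d + 1) → ℤ) :
    |pk m F z| ≤ (2 * (d + 1 : ℝ) + 1) * B := by
  have hB : 0 ≤ B := (abs_nonneg _).trans (hF 0)
  cases m with
  | zero => rw [pk_zero]; nlinarith [hF z]
  | succ q =>
    have e : pk (q + 1) F z = smooth (q + 1) F z + ((q : ℝ) + 1) * (smooth (q + 1) F z - smooth q F z) := by
      simp only [pk, rho, Nat.add_sub_cancel]; push_cast; ring
    rw [e]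
    have h1 : |smooth (q + 1) F z| ≤ B := smoothL_bound _ _ hF z
    have h2 := smoothL_succ_sub_le_of_bound (List.finRange (d + 1)) q hF z
    rw [List.length_finRange] at h2
    have hW : (0 : ℝ) < 2 * q + 3 := by positivity
    have h3 : ((q : ℝ) + 1) * |smooth (q + 1) F z - smooth q F z| ≤ 2 * (d + 1 : ℝ) * B := by
      calc ((q : ℝ) + 1) * |smooth (q + 1) F z - smooth q F z|
          ≤ ((q : ℝ) + 1) * (((d + 1 : ℕ) : ℝ) * (4 * B / (2 * q + 3))) := by gcongr; exact h2
        _ = (4 * ((q : ℝ) + 1) / (2 * q + 3)) * ((d + 1 : ℝ) * B) := by push_cast; ring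
        _ ≤ 2 * ((d + 1 : ℝ) * B) := by
            refine mul_le_mul_of_nonneg_right ?_ (by positivity)
            rw [div_le_iff₀ hW]; nlinarith
        _ = 2 * (d + 1 : ℝ) * B := by ring
    calc |smooth (q + 1) F z + ((q : ℝ) + 1) * (smooth (q + 1) F z - smooth q F z)|
        ≤ |smooth (q + 1) F z| + |((q : ℝ) + 1) * (smooth (q + 1) F z - smooth q F z)| := abs_add_le _ _
      _ = |smooth (q + 1) F z| + ((q : ℝ) + 1) * |smooth (q + 1) F z - smooth q F z| := by
          rw [abs_mul, abs_of_pos (by positivity : (0 : ℝ) < q + 1)]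
      _ ≤ B + 2 * (d + 1 : ℝ) * B := add_le_add h1 h3
      _ = (2 * (d + 1 : ℝ) + 1) * B := by ring

/-- **SCALE STEP OF `P_m` ON A LIPSCHITZ FUNCTION**: `|P_{m+1}f − P_m f| ≤ (4(d+1)² + 5(d+1))κ`. [folklore] -/
private theorem pk_step_le (m : ℕ) {f : (Fin (d + 1) → ℤ) → ℝ} {κ : ℝ} (hf : ∀ i w, |f (w + e1 i) - f w| ≤ κ)
    (z : Fin (d + 1) → ℤ) : |pk (m + 1) f z - pk m f z| ≤ (4 * (d + 1 : ℝ) ^ 2 + 5 * (d + 1 : ℝ)) * κ := by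
  have hκ : 0 ≤ κ := kappa_nonneg (hf 0)
  have hD : (1 : ℝ) ≤ (d + 1 : ℝ) := by norm_cast; omega
  cases m with
  | zero =>
    have e : pk 1 f z - pk 0 f z = 2 * (smooth 1 f z - smooth 0 f z) := by
      simp only [pk, rho]; push_cast; ring
    rw [e, abs_mul, abs_two]
    have h := smoothL_succ_sub_le (List.finRange (d + 1)) 0 hf z
    rw [List.length_finRange] at h
    push_cast at h
    calc 2 * |smooth 1 f z - smooth 0 f z| ≤ 2 * ((d + 1 : ℝ) * (2 * κ)) := by gcongr; exact h
      _ ≤ (4 * (d + 1 : ℝ) ^ 2 + 5 * (d + 1 : ℝ)) * κ := by nlinarith [mul_nonneg hκ (by linarith : (0:ℝ) ≤ d + 1)]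
  | succ q =>
    have e : pk (q + 2) f z - pk (q + 1) f z
        = ((q : ℝ) + 1) * (smooth (q + 2) f z - 2 * smooth (q + 1) f z + smooth q f z)
          + 2 * (smooth (q + 2) f z - smooth (q + 1) f z) := by
      have ea : q + 2 - 1 = q + 1 := by omega
      have eb : q + 2 + 1 - 1 = q + 2 := by omega
      simp only [pk, rho, ea, eb]
      push_cast; ring
    rw [e]
    have h1 := smoothL_scale_d2_le (List.finRange (d + 1)) q hf z
    have h2 := smoothL_succ_sub_le (List.finRange (d + 1)) (q + 1) hf z
    rw [show q + 1 + 1 = q + 2 from rfl] at h2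
    rw [List.length_finRange] at h1 h2
    push_cast at h1 h2
    change ((q : ℝ) + 1) * |smooth (q + 2) f z - 2 * smooth (q + 1) f z + smooth q f z|
      ≤ (4 * ((d : ℝ) + 1) ^ 2 + ((d : ℝ) + 1)) * κ at h1
    change |smooth (q + 2) f z - smooth (q + 1) f z| ≤ ((d : ℝ) + 1) * (2 * κ) at h2
    calc |((q : ℝ) + 1) * (smooth (q + 2) f z - 2 * smooth (q + 1) f z + smooth q f z)
            + 2 * (smooth (q + 2) f z - smooth (q + 1) f z)|
        ≤ |((q : ℝ) + 1) * (smooth (q + 2) f z - 2 * smooth (q + 1) f z + smooth q f z)|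
            + |2 * (smooth (q + 2) f z - smooth (q + 1) f z)| := abs_add_le _ _
      _ = ((q : ℝ) + 1) * |smooth (q + 2) f z - 2 * smooth (q + 1) f z + smooth q f z|
            + 2 * |smooth (q + 2) f z - smooth (q + 1) f z| := by
          rw [abs_mul, abs_of_pos (by positivity : (0 : ℝ) < q + 1), abs_mul, abs_two]
      _ ≤ (4 * (d + 1 : ℝ) ^ 2 + (d + 1 : ℝ)) * κ + 2 * ((d + 1 : ℝ) * (2 * κ)) :=
          add_le_add h1 (mul_le_mul_of_nonneg_left h2 zero_le_two)
      _ = (4 * (d + 1 : ℝ) ^ 2 + 5 * (d + 1 : ℝ)) * κ := by ring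

end Smooth

/-! ## §3. The box `Π_μ [0, N_μ)`: folding, the even-extended face data and their affine interpolation -/

section BoxData

/-- **FOLDING A SUCCESSOR** (mirrors at the half-integers): `fold1 N (n+1)` is `fold1 N n + 1`, `fold1 N n` or
`fold1 N n − 1`. [folklore] -/
private theorem fold1_succ_trichotomy {N : ℕ} (hN : 1 ≤ N) (n : ℤ) :
    fold1 N (n + 1) = fold1 N n + 1 ∨ fold1 N (n + 1) = fold1 N n ∨ fold1 N (n + 1) = fold1 N n - 1 := by
  have h0 : 0 ≤ n % (2 * N : ℤ) := Int.emod_nonneg _ (by omega)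
  have h1 : n % (2 * N : ℤ) < 2 * N := Int.emod_lt_of_pos _ (by omega)
  have hs : (n + 1) % (2 * N : ℤ) = (n % (2 * N : ℤ) + 1) % (2 * N : ℤ) := (Int.emod_add_emod n (2 * N) 1).symm
  have hs' : (n + 1) % (2 * N : ℤ) = if n % (2 * N : ℤ) + 1 < 2 * N then n % (2 * N : ℤ) + 1 else 0 := by
    rw [hs]
    split_ifs with h
    · exact Int.emod_eq_of_lt (by omega) h
    · have e : n % (2 * N : ℤ) + 1 = 2 * N := by omega
      rw [e, Int.emod_self]
  unfold fold1
  rw [hs']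
  split_ifs <;> omega

/-- folding a lattice step: `foldBox N (z + e_i)` differs from `foldBox N z` only in the coordinate `i`. [folklore] -/
private theorem foldBox_add_e1 (N : Fin (d + 1) → ℕ) (z : Fin (d + 1) → ℤ) (i : Fin (d + 1)) :
    foldBox N (z + e1 i) = Function.update (foldBox N z) i (fold1 (N i) (z i + 1)) := by
  funext k
  by_cases hk : k = i
  · subst hk; simp [foldBox]
  · simp [foldBox, hk, e1_apply_ne hk]

/-- updating a coordinate by a shift is adding a multiple of the unit vector. [folklore] -/
private theorem update_add_eq (y : Fin (d + 1) → ℤ) (i : Fin (d + 1)) (t : ℤ) :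
    Function.update y i (y i + t) = y + t • e1 i := by
  funext k
  by_cases hk : k = i
  · subst hk; simp [e1]
  · simp [hk, e1_apply_ne hk]

/-- **FOLDING IS REFLECTION INVARIANT** at the lower mirror `−1/2` of direction `μ`. [folklore] -/
private theorem foldBox_reflC_lo (N : Fin (d + 1) → ℕ) (hN : ∀ μ, 1 ≤ N μ) (μ : Fin (d + 1)) (z : Fin (d + 1) → ℤ) :
    foldBox N (reflC μ (-1) z) = foldBox N z := by
  funext k
  by_cases hk : k = μ
  · subst hk
    simp only [foldBox_apply, reflC, Function.update_self]
    have h := fold1_reflect (hN k) (z k) 0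
    rw [mul_zero, zero_sub] at h
    exact h
  · simp [foldBox, reflC, hk]

/-- folding is reflection invariant at the upper mirror `N_μ − 1/2` of direction `μ`. [folklore] -/
private theorem foldBox_reflC_hi (N : Fin (d + 1) → ℕ) (hN : ∀ μ, 1 ≤ N μ) (μ : Fin (d + 1)) (z : Fin (d + 1) → ℤ) :
    foldBox N (reflC μ (2 * (N μ : ℤ) - 1) z) = foldBox N z := by
  funext k
  by_cases hk : k = μ
  · subst hk
    simp only [foldBox_apply, reflC, Function.update_self]
    have h := fold1_reflect (hN k) (z k) 1
    rw [mul_one] at h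
    exact h
  · simp [foldBox, reflC, hk]

/-- folding ignores nothing but is insensitive to later overwriting: the folded point with coordinate `μ` overwritten
does not see `z_μ`. [folklore] -/
private theorem update_foldBox_add_zsmul (N : Fin (d + 1) → ℕ) (μ : Fin (d + 1)) (c t : ℤ) (z : Fin (d + 1) → ℤ) :
    Function.update (foldBox N (z + t • e1 μ)) μ c = Function.update (foldBox N z) μ c := by
  funext k
  by_cases hk : k = μ
  · subst hk; simp
  · simp [foldBox, hk, e1_apply_ne hk]

variable (N : Fin (d + 1) → ℕ) (Ac : (Fin (d + 1) → ℤ) → Fin (d + 1) → ℝ)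

/-- **NEAR-FACE DATA** of direction `μ`, evenly extended to `ℤ^{d+1}`: `g⁰_μ(z) = A_μ(x)` at the box point `x` with
`x_μ = 0` over the folded tangential position of `z` (the normal component on the first bond layer of the face `x_μ = 0`).
[cite: Balaban1983RegularityDecay, p.577 «constant in a neighbourhood of the boundary of □», dictionary] -/
def faceLo (μ : Fin (d + 1)) : (Fin (d + 1) → ℤ) → ℝ := fun z => Ac (Function.update (foldBox N z) μ 0) μ

/-- **FAR-FACE DATA** of direction `μ`: the normal component on the last bond layer `x_μ = N_μ − 2`, evenly extended.
[cite: Balaban1983RegularityDecay, p.577 «constant in a neighbourhood of the boundary of □», dictionary] -/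
def faceHi (μ : Fin (d + 1)) : (Fin (d + 1) → ℤ) → ℝ :=
  fun z => Ac (Function.update (foldBox N z) μ ((N μ : ℤ) - 2)) μ

/-- the number of normal bond layers minus one: `c_μ = N_μ − 2`. [folklore] -/
def cLen (μ : Fin (d + 1)) : ℕ := N μ - 2

/-- **THE AFFINE INTERPOLATION** `G^μ_s = ((c−s)g⁰ + s g¹)/c` between the two face data (`s` = bond layer).
[cite: Balaban1983RegularityDecay, p.579 «we can apply Lemma 2.2 to all operators in it», dictionary] -/
def faceData (μ : Fin (d + 1)) (s : ℕ) : (Fin (d + 1) → ℤ) → ℝ :=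
  fun z => (((cLen N μ : ℝ) - s) / (cLen N μ : ℝ)) * faceLo N Ac μ z + ((s : ℝ) / (cLen N μ : ℝ)) * faceHi N Ac μ z

/-- the constant increment `δ^μ = (g¹ − g⁰)/c` of the interpolation. [folklore] -/
def faceInc (μ : Fin (d + 1)) : (Fin (d + 1) → ℤ) → ℝ := fun z => (faceHi N Ac μ z - faceLo N Ac μ z) / (cLen N μ : ℝ)

variable {N Ac}

/-- the interpolation steps by the constant increment. [folklore] -/
private theorem faceData_succ (μ : Fin (d + 1)) (s : ℕ) : faceData N Ac μ (s + 1) = faceData N Ac μ s + faceInc N Ac μ := by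
  funext z
  simp only [faceData, faceInc, Pi.add_apply, Nat.cast_succ]
  ring

/-- at `s = 0` the interpolation is the near-face datum. [folklore] -/
private theorem faceData_zero (hN : ∀ μ, 3 ≤ N μ) (μ : Fin (d + 1)) : faceData N Ac μ 0 = faceLo N Ac μ := by
  funext z
  have hc : (cLen N μ : ℝ) ≠ 0 := by
    have : 1 ≤ cLen N μ := by unfold cLen; have := hN μ; omega
    positivity
  simp only [faceData, Nat.cast_zero, sub_zero, div_self hc, zero_div]; ring

/-- at `s = c` the interpolation is the far-face datum. [folklore] -/
private theorem faceData_cLen (hN : ∀ μ, 3 ≤ N μ) (μ : Fin (d + 1)) : faceData N Ac μ (cLen N μ) = faceHi N Ac μ := by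
  funext z
  have hc : (cLen N μ : ℝ) ≠ 0 := by
    have : 1 ≤ cLen N μ := by unfold cLen; have := hN μ; omega
    positivity
  simp only [faceData, sub_self, zero_div, div_self hc]; ring

/-- the face data do not depend on the normal coordinate. [folklore] -/
private theorem faceLo_add_zsmul (μ : Fin (d + 1)) (t : ℤ) (z : Fin (d + 1) → ℤ) :
    faceLo N Ac μ (z + t • e1 μ) = faceLo N Ac μ z := by
  simp only [faceLo, update_foldBox_add_zsmul]

/-- the far-face data do not depend on the normal coordinate. [folklore] -/
private theorem faceHi_add_zsmul (μ : Fin (d + 1)) (t : ℤ) (z : Fin (d + 1) → ℤ) :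
    faceHi N Ac μ (z + t • e1 μ) = faceHi N Ac μ z := by
  simp only [faceHi, update_foldBox_add_zsmul]

/-- the interpolation does not depend on the normal coordinate. [folklore] -/
private theorem faceData_add_e1 (μ : Fin (d + 1)) (s : ℕ) (z : Fin (d + 1) → ℤ) :
    faceData N Ac μ s (z + e1 μ) = faceData N Ac μ s z := by
  have h1 := faceLo_add_zsmul (N := N) (Ac := Ac) μ 1 z
  have h2 := faceHi_add_zsmul (N := N) (Ac := Ac) μ 1 z
  rw [one_zsmul] at h1 h2
  simp only [faceData, h1, h2]

/-- the face data are EVEN under the lower mirror of any direction. [folklore] -/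
private theorem faceData_reflC_lo (hN : ∀ μ, 3 ≤ N μ) (μ : Fin (d + 1)) (s : ℕ) (i : Fin (d + 1)) (z : Fin (d + 1) → ℤ) :
    faceData N Ac μ s (reflC i (-1) z) = faceData N Ac μ s z := by
  have hN1 : ∀ μ, 1 ≤ N μ := fun μ => le_trans (by norm_num) (hN μ)
  simp only [faceData, faceLo, faceHi, foldBox_reflC_lo N hN1]

/-- the face data are even under the upper mirror of any direction. [folklore] -/
private theorem faceData_reflC_hi (hN : ∀ μ, 3 ≤ N μ) (μ : Fin (d + 1)) (s : ℕ) (i : Fin (d + 1)) (z : Fin (d + 1) → ℤ) :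
    faceData N Ac μ s (reflC i (2 * (N i : ℤ) - 1) z) = faceData N Ac μ s z := by
  have hN1 : ∀ μ, 1 ≤ N μ := fun μ => le_trans (by norm_num) (hN μ)
  simp only [faceData, faceLo, faceHi, foldBox_reflC_hi N hN1]

/-- **THE FACE DATA INHERIT (1.7)**: one-step differences of `g⁰_μ` in every lattice direction are bounded by `κ`
(steps in the tangential directions fold to steps, stalls or reversed steps inside the box; the normal direction is
invisible). [cite: Balaban1983RegularityDecay, (1.7) p.572] -/
theorem faceLo_lip (hN : ∀ μ, 3 ≤ N μ) {κ : ℝ}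
    (hreg : ∀ x ∈ boxDom N, ∀ i ν : Fin (d + 1), |Ac (x + e1 i) ν - Ac x ν| ≤ κ)
    (μ i : Fin (d + 1)) (z : Fin (d + 1) → ℤ) : |faceLo N Ac μ (z + e1 i) - faceLo N Ac μ z| ≤ κ := by
  have hN1 : ∀ μ, 1 ≤ N μ := fun μ => le_trans (by norm_num) (hN μ)
  have hκ : 0 ≤ κ := (abs_nonneg _).trans (hreg _ (foldBox_mem_boxDom hN1 0) 0 0)
  by_cases hi : i = μ
  · subst hi
    have h := faceLo_add_zsmul (N := N) (Ac := Ac) i 1 z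
    rw [one_zsmul] at h
    rw [h, sub_self, abs_zero]; exact hκ
  · set y := Function.update (foldBox N z) μ 0 with hy
    have hymem : y ∈ boxDom N := by
      rw [mem_boxDom]; intro k
      by_cases hk : k = μ
      · subst hk; simp [hy]; have := hN k; omega
      · simp only [hy, Function.update_of_ne hk, foldBox_apply]
        exact ⟨fold1_nonneg (hN1 k) _, fold1_lt (hN1 k) _⟩
    have hyi : y i = fold1 (N i) (z i) := by simp [hy, Function.update_of_ne hi]
    have e : faceLo N Ac μ (z + e1 i) = Ac (Function.update y i (fold1 (N i) (z i + 1))) μ := by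
      simp only [faceLo, foldBox_add_e1, hy]
      rw [Function.update_comm hi]
    have e0 : faceLo N Ac μ z = Ac y μ := rfl
    rw [e, e0]
    rcases fold1_succ_trichotomy (hN1 i) (z i) with h | h | h
    · rw [h, ← hyi, update_add_eq, one_zsmul]
      exact hreg y hymem i μ
    · rw [h, ← hyi, Function.update_eq_self, sub_self, abs_zero]; exact hκ
    · have hge : 1 ≤ y i := by rw [hyi]; have := fold1_nonneg (hN1 i) (z i + 1); omega
      rw [h, ← hyi, show y i - 1 = y i + (-1) by ring, update_add_eq, neg_one_zsmul]
      have hmem' : y + -e1 i ∈ boxDom N := by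
        rw [mem_boxDom] at hymem ⊢
        intro k
        by_cases hk : k = i
        · subst hk; simp; constructor <;> [omega; exact by have := (hymem k).2; omega]
        · simp [e1_apply_ne hk]; exact hymem k
      have h' := hreg (y + -e1 i) hmem' i μ
      rw [show y + -e1 i + e1 i = y by simp] at h'
      rwa [abs_sub_comm] at h'

/-- the far-face data inherit (1.7). [cite: Balaban1983RegularityDecay, (1.7) p.572] -/
theorem faceHi_lip (hN : ∀ μ, 3 ≤ N μ) {κ : ℝ}
    (hreg : ∀ x ∈ boxDom N, ∀ i ν : Fin (d + 1), |Ac (x + e1 i) ν - Ac x ν| ≤ κ)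
    (μ i : Fin (d + 1)) (z : Fin (d + 1) → ℤ) : |faceHi N Ac μ (z + e1 i) - faceHi N Ac μ z| ≤ κ := by
  have hN1 : ∀ μ, 1 ≤ N μ := fun μ => le_trans (by norm_num) (hN μ)
  have hκ : 0 ≤ κ := (abs_nonneg _).trans (hreg _ (foldBox_mem_boxDom hN1 0) 0 0)
  by_cases hi : i = μ
  · subst hi
    have h := faceHi_add_zsmul (N := N) (Ac := Ac) i 1 z
    rw [one_zsmul] at h
    rw [h, sub_self, abs_zero]; exact hκ
  · set y := Function.update (foldBox N z) μ ((N μ : ℤ) - 2) with hy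
    have hymem : y ∈ boxDom N := by
      rw [mem_boxDom]; intro k
      by_cases hk : k = μ
      · subst hk; simp [hy]; have := hN k; omega
      · simp only [hy, Function.update_of_ne hk, foldBox_apply]
        exact ⟨fold1_nonneg (hN1 k) _, fold1_lt (hN1 k) _⟩
    have hyi : y i = fold1 (N i) (z i) := by simp [hy, Function.update_of_ne hi]
    have e : faceHi N Ac μ (z + e1 i) = Ac (Function.update y i (fold1 (N i) (z i + 1))) μ := by
      simp only [faceHi, foldBox_add_e1, hy]
      rw [Function.update_comm hi]
    have e0 : faceHi N Ac μ z = Ac y μ := rfl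
    rw [e, e0]
    rcases fold1_succ_trichotomy (hN1 i) (z i) with h | h | h
    · rw [h, ← hyi, update_add_eq, one_zsmul]
      exact hreg y hymem i μ
    · rw [h, ← hyi, Function.update_eq_self, sub_self, abs_zero]; exact hκ
    · have hge : 1 ≤ y i := by rw [hyi]; have := fold1_nonneg (hN1 i) (z i + 1); omega
      rw [h, ← hyi, show y i - 1 = y i + (-1) by ring, update_add_eq, neg_one_zsmul]
      have hmem' : y + -e1 i ∈ boxDom N := by
        rw [mem_boxDom] at hymem ⊢
        intro k
        by_cases hk : k = i
        · subst hk; simp; constructor <;> [omega; exact by have := (hymem k).2; omega]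
        · simp [e1_apply_ne hk]; exact hymem k
      have h' := hreg (y + -e1 i) hmem' i μ
      rw [show y + -e1 i + e1 i = y by simp] at h'
      rwa [abs_sub_comm] at h'

/-- walking `n` normal steps inside the box from the near-face point. [cite: Balaban1983RegularityDecay, (1.7) p.572] -/
theorem lip_along_box {κ : ℝ}
    (hreg : ∀ x ∈ boxDom N, ∀ i ν : Fin (d + 1), |Ac (x + e1 i) ν - Ac x ν| ≤ κ)
    (y : Fin (d + 1) → ℤ) (μ ν : Fin (d + 1)) (n : ℕ) (hmem : ∀ j : ℕ, j < n → y + (j : ℤ) • e1 μ ∈ boxDom N) :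
    |Ac (y + (n : ℤ) • e1 μ) ν - Ac y ν| ≤ n * κ := by
  induction n with
  | zero => simp
  | succ n ih =>
    have h1 := ih fun j hj => hmem j (by omega)
    have h2 := hreg _ (hmem n (by omega)) μ ν
    have e : y + ((n + 1 : ℕ) : ℤ) • e1 μ = y + (n : ℤ) • e1 μ + e1 μ := by
      rw [Nat.cast_succ, add_zsmul, one_zsmul, add_assoc]
    rw [e]
    calc |Ac (y + (n : ℤ) • e1 μ + e1 μ) ν - Ac y ν|
        = |(Ac (y + (n : ℤ) • e1 μ + e1 μ) ν - Ac (y + (n : ℤ) • e1 μ) ν) + (Ac (y + (n : ℤ) • e1 μ) ν - Ac y ν)| := by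
          ring_nf
      _ ≤ κ + n * κ := (abs_add_le _ _).trans (add_le_add h2 h1)
      _ = (n + 1 : ℕ) * κ := by push_cast; ring

/-- **THE TWO FACE DATA DIFFER BY AT MOST `cκ`** (`c = N_μ − 2` normal steps inside the box).
[cite: Balaban1983RegularityDecay, (1.7) p.572] -/
theorem faceHi_sub_faceLo_le (hN : ∀ μ, 3 ≤ N μ) {κ : ℝ}
    (hreg : ∀ x ∈ boxDom N, ∀ i ν : Fin (d + 1), |Ac (x + e1 i) ν - Ac x ν| ≤ κ)
    (μ : Fin (d + 1)) (z : Fin (d + 1) → ℤ) : |faceHi N Ac μ z - faceLo N Ac μ z| ≤ (cLen N μ) * κ := by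
  have hN1 : ∀ μ, 1 ≤ N μ := fun μ => le_trans (by norm_num) (hN μ)
  set y := Function.update (foldBox N z) μ 0 with hy
  have e : Function.update (foldBox N z) μ ((N μ : ℤ) - 2) = y + ((cLen N μ : ℕ) : ℤ) • e1 μ := by
    have h0 : y μ = 0 := by simp [hy]
    have : Function.update (foldBox N z) μ ((N μ : ℤ) - 2) = Function.update y μ (y μ + ((cLen N μ : ℕ) : ℤ)) := by
      rw [h0, zero_add, hy, Function.update_idem]
      congr 1; unfold cLen; have := hN μ; push_cast [Nat.cast_sub (by omega : 2 ≤ N μ)]; ring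
    rw [this, update_add_eq]
  have hmem : ∀ j : ℕ, j < cLen N μ → y + (j : ℤ) • e1 μ ∈ boxDom N := by
    intro j hj
    rw [mem_boxDom]; intro k
    by_cases hk : k = μ
    · subst hk; simp [hy]; unfold cLen at hj; omega
    · simp [hy, hk, e1_apply_ne hk]; exact ⟨fold1_nonneg (hN1 k) _, fold1_lt (hN1 k) _⟩
  have h := lip_along_box (N := N) hreg y μ μ (cLen N μ) hmem
  simp only [faceHi, faceLo, e]
  exact h

/-- the increment is bounded by `κ`. [cite: Balaban1983RegularityDecay, (1.7) p.572] -/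
theorem faceInc_bound (hN : ∀ μ, 3 ≤ N μ) {κ : ℝ}
    (hreg : ∀ x ∈ boxDom N, ∀ i ν : Fin (d + 1), |Ac (x + e1 i) ν - Ac x ν| ≤ κ)
    (μ : Fin (d + 1)) (z : Fin (d + 1) → ℤ) : |faceInc N Ac μ z| ≤ κ := by
  have hc : (0 : ℝ) < cLen N μ := by
    have : 1 ≤ cLen N μ := by unfold cLen; have := hN μ; omega
    positivity
  unfold faceInc
  rw [abs_div, abs_of_pos hc, div_le_iff₀ hc, mul_comm]
  exact faceHi_sub_faceLo_le hN hreg μ z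

/-- the increment is `(2κ/c)`-Lipschitz in every direction. [cite: Balaban1983RegularityDecay, (1.7) p.572] -/
theorem faceInc_lip (hN : ∀ μ, 3 ≤ N μ) {κ : ℝ}
    (hreg : ∀ x ∈ boxDom N, ∀ i ν : Fin (d + 1), |Ac (x + e1 i) ν - Ac x ν| ≤ κ)
    (μ i : Fin (d + 1)) (z : Fin (d + 1) → ℤ) :
    |faceInc N Ac μ (z + e1 i) - faceInc N Ac μ z| ≤ 2 * κ / (cLen N μ) := by
  have hc : (0 : ℝ) < cLen N μ := by
    have : 1 ≤ cLen N μ := by unfold cLen; have := hN μ; omega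
    positivity
  have e : faceInc N Ac μ (z + e1 i) - faceInc N Ac μ z
      = ((faceHi N Ac μ (z + e1 i) - faceHi N Ac μ z) - (faceLo N Ac μ (z + e1 i) - faceLo N Ac μ z))
        / (cLen N μ) := by
    unfold faceInc; field_simp; ring
  rw [e, abs_div, abs_of_pos hc, div_le_div_iff_of_pos_right hc]
  calc |faceHi N Ac μ (z + e1 i) - faceHi N Ac μ z - (faceLo N Ac μ (z + e1 i) - faceLo N Ac μ z)|
      ≤ |faceHi N Ac μ (z + e1 i) - faceHi N Ac μ z| + |faceLo N Ac μ (z + e1 i) - faceLo N Ac μ z| := abs_sub _ _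
    _ ≤ κ + κ := add_le_add (faceHi_lip hN hreg μ i z) (faceLo_lip hN hreg μ i z)
    _ = 2 * κ := by ring

/-- **THE INTERPOLATED DATA ARE `κ`-LIPSCHITZ** for `0 ≤ s ≤ c` (convex combination).
[cite: Balaban1983RegularityDecay, (1.7) p.572] -/
theorem faceData_lip (hN : ∀ μ, 3 ≤ N μ) {κ : ℝ}
    (hreg : ∀ x ∈ boxDom N, ∀ i ν : Fin (d + 1), |Ac (x + e1 i) ν - Ac x ν| ≤ κ)
    (μ : Fin (d + 1)) {s : ℕ} (hs : s ≤ cLen N μ) (i : Fin (d + 1)) (z : Fin (d + 1) → ℤ) :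
    |faceData N Ac μ s (z + e1 i) - faceData N Ac μ s z| ≤ κ := by
  have hc : (0 : ℝ) < cLen N μ := by
    have : 1 ≤ cLen N μ := by unfold cLen; have := hN μ; omega
    positivity
  have ha : 0 ≤ ((cLen N μ : ℝ) - s) / (cLen N μ : ℝ) := by
    apply div_nonneg _ hc.le; rw [sub_nonneg]; exact_mod_cast hs
  have hb : 0 ≤ (s : ℝ) / (cLen N μ : ℝ) := by positivity
  have hab : ((cLen N μ : ℝ) - s) / (cLen N μ : ℝ) + (s : ℝ) / (cLen N μ : ℝ) = 1 := by
    field_simp; ring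
  have e : faceData N Ac μ s (z + e1 i) - faceData N Ac μ s z
      = ((cLen N μ : ℝ) - s) / (cLen N μ : ℝ) * (faceLo N Ac μ (z + e1 i) - faceLo N Ac μ z)
        + (s : ℝ) / (cLen N μ : ℝ) * (faceHi N Ac μ (z + e1 i) - faceHi N Ac μ z) := by
    unfold faceData; ring
  rw [e]
  calc |((cLen N μ : ℝ) - s) / (cLen N μ : ℝ) * (faceLo N Ac μ (z + e1 i) - faceLo N Ac μ z)
          + (s : ℝ) / (cLen N μ : ℝ) * (faceHi N Ac μ (z + e1 i) - faceHi N Ac μ z)|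
      ≤ |((cLen N μ : ℝ) - s) / (cLen N μ : ℝ) * (faceLo N Ac μ (z + e1 i) - faceLo N Ac μ z)|
          + |(s : ℝ) / (cLen N μ : ℝ) * (faceHi N Ac μ (z + e1 i) - faceHi N Ac μ z)| := abs_add_le _ _
    _ = ((cLen N μ : ℝ) - s) / (cLen N μ : ℝ) * |faceLo N Ac μ (z + e1 i) - faceLo N Ac μ z|
          + (s : ℝ) / (cLen N μ : ℝ) * |faceHi N Ac μ (z + e1 i) - faceHi N Ac μ z| := by
        rw [abs_mul, abs_mul, abs_of_nonneg ha, abs_of_nonneg hb]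
    _ ≤ ((cLen N μ : ℝ) - s) / (cLen N μ : ℝ) * κ + (s : ℝ) / (cLen N μ : ℝ) * κ := by
        gcongr
        · exact faceLo_lip hN hreg μ i z
        · exact faceHi_lip hN hreg μ i z
    _ = κ := by rw [← add_mul, hab, one_mul]

end BoxData

/-! ## §4. The scale schedule `m(s) = min(s, c − s)`, Abel summation over its two monotone runs, and the three
second-difference estimates of `Λ = Σ_{s<n} P_{m(s)} G_s` -/

section Runs

/-- **THE SCALE SCHEDULE** along the normal coordinate: smoothing radius `m(s) = min(s, c − s)` at bond layer `s`
(zero at both faces, slope `±1`). [folklore] -/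
def mrun (c s : ℕ) : ℕ := min s (c - s)

/-- `m(0) = 0`. [folklore] -/
@[simp] private theorem mrun_zero (c : ℕ) : mrun c 0 = 0 := by simp [mrun]

/-- `m(c) = 0`. [folklore] -/
@[simp] private theorem mrun_self (c : ℕ) : mrun c c = 0 := by simp [mrun]

/-- consecutive radii differ by at most one. [folklore] -/
private theorem mrun_succ (c s : ℕ) :
    mrun c (s + 1) = mrun c s + 1 ∨ mrun c (s + 1) = mrun c s ∨ mrun c (s + 1) + 1 = mrun c s := by
  unfold mrun; omega

/-- **THE GAUGE SUM OF ONE DIRECTION** `Λ_n = Σ_{s<n} P_{m(s)} G_s` (as a lattice function). [folklore] -/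
def runSum (c : ℕ) (G : ℕ → (Fin (d + 1) → ℤ) → ℝ) (n : ℕ) : (Fin (d + 1) → ℤ) → ℝ :=
  fun z => ∑ s ∈ Finset.range n, pk (mrun c s) (G s) z

/-- **ABEL SUMMATION ON AN INCREASING RUN** (`m(s+1) = m(s) + 1`): the `P`-sum collapses to two boundary `ρ`-terms and
a sum of `ρ`'s applied to the constant increment `δ = G_{s+1} − G_s`. [folklore] -/
private theorem sum_pk_inc (m : ℕ → ℕ) (G : ℕ → (Fin (d + 1) → ℤ) → ℝ) (δ : (Fin (d + 1) → ℤ) → ℝ)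
    (hG : ∀ s, G (s + 1) = G s + δ) (n : ℕ) (hm : ∀ s, s < n → m (s + 1) = m s + 1) (z : Fin (d + 1) → ℤ) :
    ∑ s ∈ Finset.range (n + 1), pk (m s) (G s) z
      = rho (m n + 1) (G n) z - rho (m 0) (G 0) z - ∑ s ∈ Finset.range n, rho (m s + 1) δ z := by
  induction n with
  | zero => simp [pk]
  | succ n ih =>
    rw [Finset.sum_range_succ, ih fun s hs => hm s (by omega), Finset.sum_range_succ, hm n (by omega), hG n]
    simp only [pk, rho_add]
    ring

/-- **ABEL SUMMATION ON A DECREASING RUN** (`m(s) = m(s+1) + 1`). [folklore] -/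
private theorem sum_pk_dec (m : ℕ → ℕ) (G : ℕ → (Fin (d + 1) → ℤ) → ℝ) (δ : (Fin (d + 1) → ℤ) → ℝ)
    (hG : ∀ s, G (s + 1) = G s + δ) (a n : ℕ) (hm : ∀ s, a ≤ s → s < a + n → m s = m (s + 1) + 1)
    (z : Fin (d + 1) → ℤ) :
    ∑ s ∈ Finset.Ico a (a + n + 1), pk (m s) (G s) z
      = rho (m a + 1) (G a) z - rho (m (a + n)) (G (a + n)) z + ∑ s ∈ Finset.Ico a (a + n), rho (m s) δ z := by
  induction n with
  | zero => simp [pk]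
  | succ n ih =>
    rw [show a + (n + 1) + 1 = (a + n + 1) + 1 by ring, Finset.sum_Ico_succ_top (by omega : a ≤ a + n + 1),
      ih fun s hs hs' => hm s hs (by omega), show a + (n + 1) = a + n + 1 by ring,
      Finset.sum_Ico_succ_top (by omega : a ≤ a + n), hG (a + n), hm (a + n) (by omega) (by omega)]
    simp only [pk, rho_add]
    ring

/-- `∂_i∂_ν` of a finite sum of lattice functions. [folklore] -/
private theorem d2_sum (i ν : Fin (d + 1)) (S : Finset ℕ) (f : ℕ → (Fin (d + 1) → ℤ) → ℝ) (y : Fin (d + 1) → ℤ) :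
    d2 i ν (fun z => ∑ s ∈ S, f s z) y = ∑ s ∈ S, d2 i ν (f s) y := by
  simp only [d2, ← Finset.sum_add_distrib, ← Finset.sum_sub_distrib]

/-- `∂_i∂_ν` commutes with `P_m`. [folklore] -/
private theorem d2_pk (m : ℕ) (i ν : Fin (d + 1)) (F : (Fin (d + 1) → ℤ) → ℝ) (y : Fin (d + 1) → ℤ) :
    d2 i ν (pk m F) y = pk m (d2 i ν F) y := by
  simp only [pk, d2, rho, smooth, smoothL_d2]; ring

/-- `∂_i∂_ν` is additive. [folklore] -/
private theorem d2_add (i ν : Fin (d + 1)) (F G : (Fin (d + 1) → ℤ) → ℝ) : d2 i ν (F + G) = d2 i ν F + d2 i ν G := by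
  funext z; simp only [d2, Pi.add_apply]; ring

/-- a one-step bound on `∂_i F` from a Lipschitz hypothesis (restated for `d2 i ν F` data). [folklore] -/
private theorem d2_lip_of_lip {i : Fin (d + 1)} (ν j : Fin (d + 1)) {F : (Fin (d + 1) → ℤ) → ℝ} {κ : ℝ}
    (hF : ∀ i' w, |F (w + e1 i') - F w| ≤ κ) (w : Fin (d + 1) → ℤ) :
    |d2 i ν F (w + e1 j) - d2 i ν F w| ≤ 4 * κ := by
  have e : d2 i ν F (w + e1 j) - d2 i ν F w
      = ((F (w + e1 j + e1 i + e1 ν) - F (w + e1 i + e1 ν)) - (F (w + e1 j + e1 i) - F (w + e1 i)))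
        - ((F (w + e1 j + e1 ν) - F (w + e1 ν)) - (F (w + e1 j) - F w)) := by
    simp only [d2]; ring
  rw [e]
  have h1 := hF j (w + e1 i + e1 ν); have h2 := hF j (w + e1 i); have h3 := hF j (w + e1 ν); have h4 := hF j w
  rw [show w + e1 i + e1 ν + e1 j = w + e1 j + e1 i + e1 ν by abel] at h1
  rw [show w + e1 i + e1 j = w + e1 j + e1 i by abel] at h2
  rw [show w + e1 ν + e1 j = w + e1 j + e1 ν by abel] at h3
  calc |F (w + e1 j + e1 i + e1 ν) - F (w + e1 i + e1 ν) - (F (w + e1 j + e1 i) - F (w + e1 i))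
          - (F (w + e1 j + e1 ν) - F (w + e1 ν) - (F (w + e1 j) - F w))|
      ≤ |F (w + e1 j + e1 i + e1 ν) - F (w + e1 i + e1 ν) - (F (w + e1 j + e1 i) - F (w + e1 i))|
          + |F (w + e1 j + e1 ν) - F (w + e1 ν) - (F (w + e1 j) - F w)| := abs_sub _ _
    _ ≤ (|F (w + e1 j + e1 i + e1 ν) - F (w + e1 i + e1 ν)| + |F (w + e1 j + e1 i) - F (w + e1 i)|)
          + (|F (w + e1 j + e1 ν) - F (w + e1 ν)| + |F (w + e1 j) - F w|) := add_le_add (abs_sub _ _) (abs_sub _ _)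
    _ ≤ (κ + κ) + (κ + κ) := by gcongr
    _ = 4 * κ := by ring

/-- a sum of `k ≤ c` terms each bounded by `B/c` is bounded by `B`. [folklore] -/
private theorem sum_le_of_card_le {S : Finset ℕ} {c : ℕ} (hc : 1 ≤ c) (hS : S.card ≤ c) {g : ℕ → ℝ} {B : ℝ} (hB : 0 ≤ B)
    (hg : ∀ s ∈ S, |g s| ≤ B / c) : |∑ s ∈ S, g s| ≤ B := by
  have hc' : (0 : ℝ) < c := by exact_mod_cast hc
  calc |∑ s ∈ S, g s| ≤ ∑ s ∈ S, |g s| := Finset.abs_sum_le_sum_abs _ _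
    _ ≤ ∑ _s ∈ S, B / c := Finset.sum_le_sum hg
    _ = S.card * (B / c) := by rw [Finset.sum_const, nsmul_eq_mul]
    _ ≤ c * (B / c) := by gcongr
    _ = B := by field_simp

variable {c : ℕ} {κ : ℝ} {G : ℕ → (Fin (d + 1) → ℤ) → ℝ} {δ : (Fin (d + 1) → ℤ) → ℝ}

/-- **THE MIXED SECOND DIFFERENCES OF `Λ_n` ARE `O(κ)`** — uniformly in `n ≤ c + 1` and in the box: Abel summation
on the increasing run `s ≤ c/2` and on the decreasing run, `|∂∂(ρ_r F)| ≤ 2·Lip(F)` on the two boundary terms of each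
run, and `≤ c` increment terms of Lipschitz constant `2κ/c`. [folklore] -/
private theorem d2_runSum_le (hc : 1 ≤ c) (hG : ∀ s, G (s + 1) = G s + δ)
    (hGlip : ∀ s, s ≤ c → ∀ i w, |G s (w + e1 i) - G s w| ≤ κ)
    (hδlip : ∀ i w, |δ (w + e1 i) - δ w| ≤ 2 * κ / c) {n : ℕ} (hn : n ≤ c + 1) (i ν : Fin (d + 1))
    (y : Fin (d + 1) → ℤ) : |d2 i ν (runSum c G n) y| ≤ 14 * κ := by
  have hκ : 0 ≤ κ := kappa_nonneg (hGlip 0 (Nat.zero_le _) 0)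
  set p := c / 2 with hp
  have hp1 : 2 * p ≤ c := Nat.mul_div_le c 2
  have hp2 : c < 2 * p + 2 := by omega
  -- the sum with the differentiated data
  set G' : ℕ → (Fin (d + 1) → ℤ) → ℝ := fun s => d2 i ν (G s) with hG'def
  set δ' : (Fin (d + 1) → ℤ) → ℝ := d2 i ν δ with hδ'def
  have hG' : ∀ s, G' (s + 1) = G' s + δ' := by intro s; simp only [hG'def, hδ'def, hG s, d2_add]
  have e : d2 i ν (runSum c G n) y = ∑ s ∈ Finset.range n, pk (mrun c s) (G' s) y := by
    unfold runSum; rw [d2_sum]; simp only [d2_pk]; rfl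
  rw [e]
  -- the elementary piece bounds
  have hrhoG : ∀ s, s ≤ c → ∀ r, |rho r (G' s) y| ≤ 2 * κ := by
    intro s hs r
    rw [show rho r (G' s) y = d2 i ν (rho r (G s)) y by rw [d2_rho]]
    exact d2_rho_le r ν (hGlip s hs i) y
  have hrhoδ : ∀ r, |rho r δ' y| ≤ 4 * κ / c := by
    intro r
    rw [show rho r δ' y = d2 i ν (rho r δ) y by rw [d2_rho], show 4 * κ / c = 2 * (2 * κ / c) by ring]
    exact d2_rho_le r ν (hδlip i) y
  -- the increasing run from `s = 0` with `n₁ + 1 ≤ p + 1` terms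
  have hinc : ∀ n₁, n₁ ≤ p → |∑ s ∈ Finset.range (n₁ + 1), pk (mrun c s) (G' s) y| ≤ 6 * κ := by
    intro n₁ hn₁
    have hm : ∀ s, s < n₁ → mrun c (s + 1) = mrun c s + 1 := by intro s hs; unfold mrun; omega
    rw [sum_pk_inc (mrun c) G' δ' hG' n₁ hm y, mrun_zero, rho_zero, sub_zero]
    have h1 := hrhoG n₁ (by omega) (mrun c n₁ + 1)
    have h2 : |∑ s ∈ Finset.range n₁, rho (mrun c s + 1) δ' y| ≤ 4 * κ :=
      sum_le_of_card_le hc (by rw [Finset.card_range]; omega) (by positivity) fun s _ => hrhoδ _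
    calc |rho (mrun c n₁ + 1) (G' n₁) y - ∑ s ∈ Finset.range n₁, rho (mrun c s + 1) δ' y|
        ≤ |rho (mrun c n₁ + 1) (G' n₁) y| + |∑ s ∈ Finset.range n₁, rho (mrun c s + 1) δ' y| := abs_sub _ _
      _ ≤ 2 * κ + 4 * κ := add_le_add h1 h2
      _ = 6 * κ := by ring
  by_cases hnp : n ≤ p + 1
  · -- only the increasing run occurs
    cases n with
    | zero => simp; linarith
    | succ n₁ => exact (hinc n₁ (by omega)).trans (by linarith)
  · -- both runs: split at `p + 1`, the decreasing run has `n₂ + 1` terms, `n = p + 1 + n₂ + 1`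
    obtain ⟨n₂, hn₂⟩ : ∃ n₂, n = p + 1 + n₂ + 1 := ⟨n - p - 2, by omega⟩
    have hsplit : ∑ s ∈ Finset.range n, pk (mrun c s) (G' s) y
        = ∑ s ∈ Finset.range (p + 1), pk (mrun c s) (G' s) y
          + ∑ s ∈ Finset.Ico (p + 1) (p + 1 + n₂ + 1), pk (mrun c s) (G' s) y := by
      rw [Finset.range_eq_Ico, Finset.range_eq_Ico, hn₂]
      exact (Finset.sum_Ico_consecutive _ (Nat.zero_le _) (by omega)).symm
    have hm : ∀ s, p + 1 ≤ s → s < p + 1 + n₂ → mrun c s = mrun c (s + 1) + 1 := by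
      intro s hs hs'; unfold mrun; omega
    have hdec : |∑ s ∈ Finset.Ico (p + 1) (p + 1 + n₂ + 1), pk (mrun c s) (G' s) y| ≤ 8 * κ := by
      rw [sum_pk_dec (mrun c) G' δ' hG' (p + 1) n₂ hm y]
      have h1 := hrhoG (p + 1) (by omega) (mrun c (p + 1) + 1)
      have h2 := hrhoG (p + 1 + n₂) (by omega) (mrun c (p + 1 + n₂))
      have h3 : |∑ s ∈ Finset.Ico (p + 1) (p + 1 + n₂), rho (mrun c s) δ' y| ≤ 4 * κ :=
        sum_le_of_card_le hc (by rw [Nat.card_Ico]; omega) (by positivity) fun s _ => hrhoδ _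
      calc |rho (mrun c (p + 1) + 1) (G' (p + 1)) y - rho (mrun c (p + 1 + n₂)) (G' (p + 1 + n₂)) y
              + ∑ s ∈ Finset.Ico (p + 1) (p + 1 + n₂), rho (mrun c s) δ' y|
          ≤ |rho (mrun c (p + 1) + 1) (G' (p + 1)) y - rho (mrun c (p + 1 + n₂)) (G' (p + 1 + n₂)) y|
              + |∑ s ∈ Finset.Ico (p + 1) (p + 1 + n₂), rho (mrun c s) δ' y| := abs_add_le _ _
        _ ≤ (|rho (mrun c (p + 1) + 1) (G' (p + 1)) y| + |rho (mrun c (p + 1 + n₂)) (G' (p + 1 + n₂)) y|)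
              + |∑ s ∈ Finset.Ico (p + 1) (p + 1 + n₂), rho (mrun c s) δ' y| := by gcongr; exact abs_sub _ _
        _ ≤ (2 * κ + 2 * κ) + 4 * κ := add_le_add (add_le_add h1 h2) h3
        _ = 8 * κ := by ring
    rw [hsplit]
    calc |∑ s ∈ Finset.range (p + 1), pk (mrun c s) (G' s) y
            + ∑ s ∈ Finset.Ico (p + 1) (p + 1 + n₂ + 1), pk (mrun c s) (G' s) y|
        ≤ |∑ s ∈ Finset.range (p + 1), pk (mrun c s) (G' s) y|
            + |∑ s ∈ Finset.Ico (p + 1) (p + 1 + n₂ + 1), pk (mrun c s) (G' s) y| := abs_add_le _ _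
      _ ≤ 6 * κ + 8 * κ := add_le_add (hinc p le_rfl) hdec
      _ = 14 * κ := by ring

/-- **ONE NORMAL STEP OF THE NORMAL COMPONENT OF THE GAUGE**: `|P_{m(n+1)}G_{n+1} − P_{m(n)}G_n| ≤
((2(d+1)+1) + (4(d+1)² + 5(d+1)))κ` (`P` on the increment + one scale step of `P` on `G_n`). [folklore] -/
private theorem pk_run_step_le (hG : ∀ s, G (s + 1) = G s + δ)
    (hGlip : ∀ s, s ≤ c → ∀ i w, |G s (w + e1 i) - G s w| ≤ κ) (hδbd : ∀ w, |δ w| ≤ κ)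
    {n : ℕ} (hn : n ≤ c) (y : Fin (d + 1) → ℤ) :
    |pk (mrun c (n + 1)) (G (n + 1)) y - pk (mrun c n) (G n) y|
      ≤ ((2 * (d + 1 : ℝ) + 1) + (4 * (d + 1 : ℝ) ^ 2 + 5 * (d + 1 : ℝ))) * κ := by
  have hκ : 0 ≤ κ := (abs_nonneg _).trans (hδbd 0)
  have e : pk (mrun c (n + 1)) (G (n + 1)) y - pk (mrun c n) (G n) y
      = pk (mrun c (n + 1)) δ y + (pk (mrun c (n + 1)) (G n) y - pk (mrun c n) (G n) y) := by
    rw [hG n, pk_add]; ring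
  rw [e]
  have h1 : |pk (mrun c (n + 1)) δ y| ≤ (2 * (d + 1 : ℝ) + 1) * κ := pk_bound _ hδbd y
  have h2 : |pk (mrun c (n + 1)) (G n) y - pk (mrun c n) (G n) y| ≤ (4 * (d + 1 : ℝ) ^ 2 + 5 * (d + 1 : ℝ)) * κ := by
    rcases mrun_succ c n with h | h | h
    · rw [h]; exact pk_step_le _ (hGlip n hn) y
    · rw [h, sub_self, abs_zero]; positivity
    · rw [← h, abs_sub_comm]; exact pk_step_le _ (hGlip n hn) y
  calc |pk (mrun c (n + 1)) δ y + (pk (mrun c (n + 1)) (G n) y - pk (mrun c n) (G n) y)|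
      ≤ |pk (mrun c (n + 1)) δ y| + |pk (mrun c (n + 1)) (G n) y - pk (mrun c n) (G n) y| := abs_add_le _ _
    _ ≤ (2 * (d + 1 : ℝ) + 1) * κ + (4 * (d + 1 : ℝ) ^ 2 + 5 * (d + 1 : ℝ)) * κ := add_le_add h1 h2
    _ = ((2 * (d + 1 : ℝ) + 1) + (4 * (d + 1 : ℝ) ^ 2 + 5 * (d + 1 : ℝ))) * κ := by ring

/-- **A TANGENTIAL STEP OF THE NORMAL COMPONENT OF THE GAUGE**: `|∂_i(P_{m(n)}G_n)| ≤ (2(d+1)+1)κ`. [folklore] -/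
private theorem dDir_pk_run_le (hGlip : ∀ s, s ≤ c → ∀ i w, |G s (w + e1 i) - G s w| ≤ κ) {n : ℕ} (hn : n ≤ c)
    (i : Fin (d + 1)) (y : Fin (d + 1) → ℤ) :
    |pk (mrun c n) (G n) (y + e1 i) - pk (mrun c n) (G n) y| ≤ (2 * (d + 1 : ℝ) + 1) * κ := by
  have h := pk_bound (mrun c n) (F := dDir i (G n)) (B := κ) (hGlip n hn i) y
  rwa [← dDir_pk] at h

end Runs

/-! ## §5. The gauge function `λ = Σ_μ λ_μ`, `λ_μ(x) = −Λ^μ_{x_μ}(x)`, and the gauged field `A'' = A + dλ`: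
small normal components on both bond layers of every face, (1.7) inside the box -/

section Gauge

/-- a run sum of data not depending on some lattice direction does not depend on it. [folklore] -/
private theorem runSum_shift {c : ℕ} {G : ℕ → (Fin (d + 1) → ℤ) → ℝ} {v : Fin (d + 1) → ℤ}
    (hG : ∀ s w, G s (w + v) = G s w) (n : ℕ) (z : Fin (d + 1) → ℤ) : runSum c G n (z + v) = runSum c G n z := by
  unfold runSum
  refine Finset.sum_congr rfl fun s _ => ?_
  rw [← pk_shift]
  exact congrArg (fun F => pk (mrun c s) F z) (funext (hG s))

/-- a run sum of reflection-even data is reflection-even. [folklore] -/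
private theorem runSum_reflC {c : ℕ} {G : ℕ → (Fin (d + 1) → ℤ) → ℝ} {μ : Fin (d + 1)} {a : ℤ}
    (hG : ∀ s w, G s (reflC μ a w) = G s w) (n : ℕ) (z : Fin (d + 1) → ℤ) :
    runSum c G n (reflC μ a z) = runSum c G n z := by
  unfold runSum
  refine Finset.sum_congr rfl fun s _ => ?_
  have h : ∀ r, rho r (G s) (reflC μ a z) = rho r (G s) z := by
    intro r; rw [← rho_reflC]; exact congrArg (fun F => rho r F z) (funext (hG s))
  simp only [pk, h]

/-- one more layer. [folklore] -/
private theorem runSum_succ (c : ℕ) (G : ℕ → (Fin (d + 1) → ℤ) → ℝ) (n : ℕ) (z : Fin (d + 1) → ℤ) :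
    runSum c G (n + 1) z = runSum c G n z + pk (mrun c n) (G n) z := by
  simp only [runSum, Finset.sum_range_succ]

/-- **NORMAL DIFFERENCE AT THE LOWER FACE OF AN EVEN FUNCTION** = a second difference one step outside:
`H(x+e_μ) − H(x) = (∂_μ∂_μ H)(x − e_μ)` when `x_μ = 0` and `H` is even under the mirror at `−1/2`. [folklore] -/
private theorem dDir_of_even_lo {μ : Fin (d + 1)} {H : (Fin (d + 1) → ℤ) → ℝ} (hH : ∀ w, H (reflC μ (-1) w) = H w)
    {x : Fin (d + 1) → ℤ} (hx : x μ = 0) : H (x + e1 μ) - H x = d2 μ μ H (x - e1 μ) := by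
  have hR : reflC μ (-1) x = x - e1 μ := by
    funext k
    by_cases hk : k = μ
    · subst hk; simp [reflC, hx]
    · simp [reflC, hk, e1_apply_ne hk]
  have h1 : H (x - e1 μ) = H x := by rw [← hR]; exact hH x
  simp only [d2, sub_add_cancel, h1]

/-- **NORMAL DIFFERENCE AT THE UPPER FACE OF AN EVEN FUNCTION**: `H(x+e_μ) − H(x) = −(∂_μ∂_μ H)(x)` when
`x_μ = N_μ − 2` and `H` is even under the mirror at `N_μ − 1/2`. [folklore] -/
private theorem dDir_of_even_hi {μ : Fin (d + 1)} {Nμ : ℕ} {H : (Fin (d + 1) → ℤ) → ℝ}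
    (hH : ∀ w, H (reflC μ (2 * (Nμ : ℤ) - 1) w) = H w) {x : Fin (d + 1) → ℤ} (hx : x μ = (Nμ : ℤ) - 2) :
    H (x + e1 μ) - H x = -d2 μ μ H x := by
  have hR : reflC μ (2 * (Nμ : ℤ) - 1) (x + e1 μ) = x + e1 μ + e1 μ := by
    funext k
    by_cases hk : k = μ
    · subst hk; simp [reflC, hx]; ring
    · simp [reflC, hk, e1_apply_ne hk]
  have h1 : H (x + e1 μ + e1 μ) = H (x + e1 μ) := by rw [← hR]; exact hH (x + e1 μ)
  simp only [d2, h1]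
  ring

/-- a box point is its own fold. [folklore] -/
private theorem foldBox_eq_self_of_mem {N : Fin (d + 1) → ℕ} (hN : ∀ μ, 1 ≤ N μ) {x : Fin (d + 1) → ℤ}
    (hx : x ∈ boxDom N) : foldBox N x = x := by
  rw [mem_boxDom] at hx
  funext k
  exact fold1_of_mem (hN k) (hx k).1 (hx k).2

variable (N : Fin (d + 1) → ℕ) (Ac : (Fin (d + 1) → ℤ) → Fin (d + 1) → ℝ)

/-- **THE GAUGE FUNCTION OF ONE DIRECTION**: `λ_μ(x) = −Λ^μ_{x_μ}(x) = −Σ_{s < x_μ} (P_{m(s)} G^μ_s)(x)`; its normal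
difference is `−P_{m(x_μ)}G^μ_{x_μ}`, which at the two faces is exactly minus the normal component of `A`.
[cite: Balaban1983RegularityDecay, p.579 «we can apply Lemma 2.2 to all operators in it», p.577 «constant in a neighbourhood of the boundary of □», dictionary] -/
def lamDir (μ : Fin (d + 1)) (x : Fin (d + 1) → ℤ) : ℝ := -runSum (cLen N μ) (faceData N Ac μ) (x μ).toNat x

/-- **THE GAUGE FUNCTION** `λ = Σ_μ λ_μ` on `ℤ^{d+1}` (used on the box).
[cite: Balaban1983RegularityDecay, p.579 «we can apply Lemma 2.2 to all operators in it», dictionary] -/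
def gaugeFn (x : Fin (d + 1) → ℤ) : ℝ := ∑ μ, lamDir N Ac μ x

/-- **THE GAUGED FIELD** `A'' = A + dλ` in component form: `A''_ν(x) = A_ν(x) + λ(x + e_ν) − λ(x)` (the lineage's
`bondGauge (−λ)` on the bond `(x, x + e_ν)`). [cite: Balaban1983RegularityDecay, pp.580–581 (gauge transformations), dictionary] -/
def gauged : (Fin (d + 1) → ℤ) → Fin (d + 1) → ℝ := fun x ν => Ac x ν + gaugeFn N Ac (x + e1 ν) - gaugeFn N Ac x

variable {N Ac}

/-- the normal difference of `λ_μ`. [folklore] -/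
private theorem lamDir_step (μ : Fin (d + 1)) {y : Fin (d + 1) → ℤ} (hy : 0 ≤ y μ) :
    lamDir N Ac μ (y + e1 μ) - lamDir N Ac μ y
      = -pk (mrun (cLen N μ) (y μ).toNat) (faceData N Ac μ (y μ).toNat) y := by
  unfold lamDir
  have hn : ((y + e1 μ) μ).toNat = (y μ).toNat + 1 := by simp; omega
  rw [hn, runSum_shift (fun s w => faceData_add_e1 μ s w), runSum_succ]
  ring

/-- `λ_μ` along a step that does not move the `μ`-coordinate. [folklore] -/
private theorem lamDir_of_apply_eq (μ : Fin (d + 1)) {y : Fin (d + 1) → ℤ} {v : Fin (d + 1) → ℤ} (hv : v μ = 0) :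
    lamDir N Ac μ (y + v) = -runSum (cLen N μ) (faceData N Ac μ) (y μ).toNat (y + v) := by
  unfold lamDir; simp [hv]

/-- the hypotheses of the run estimates hold for the face data of direction `μ`. [cite: Balaban1983RegularityDecay, (1.7) p.572] -/
theorem faceData_runHyps (hN : ∀ μ, 3 ≤ N μ) {κ : ℝ}
    (hreg : ∀ x ∈ boxDom N, ∀ i ν : Fin (d + 1), |Ac (x + e1 i) ν - Ac x ν| ≤ κ) (μ : Fin (d + 1)) :
    1 ≤ cLen N μ ∧ (∀ s, faceData N Ac μ (s + 1) = faceData N Ac μ s + faceInc N Ac μ) ∧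
    (∀ s, s ≤ cLen N μ → ∀ i w, |faceData N Ac μ s (w + e1 i) - faceData N Ac μ s w| ≤ κ) ∧
    (∀ i w, |faceInc N Ac μ (w + e1 i) - faceInc N Ac μ w| ≤ 2 * κ / (cLen N μ)) ∧
    (∀ w, |faceInc N Ac μ w| ≤ κ) :=
  ⟨by unfold cLen; have := hN μ; omega, faceData_succ μ, fun _ hs i w => faceData_lip hN hreg μ hs i w,
    faceInc_lip hN hreg μ, faceInc_bound hN hreg μ⟩

/-- the constant of the face estimate: `C₂(d) = 14d`. [folklore] -/
def C2 (d : ℕ) : ℝ := 14 * d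

/-- the constant of the interior estimate: `C₁(d) = 1 + (d+1)(4(d+1)² + 9(d+1) + 16)`. [folklore] -/
def C1 (d : ℕ) : ℝ := 1 + (d + 1 : ℝ) * (4 * (d + 1 : ℝ) ^ 2 + 9 * (d + 1 : ℝ) + 16)

/-- **THE TANGENTIAL GAUGE TERMS AT A LOWER FACE ARE `O(κ)`**: for `ν ≠ μ` and `x_μ = 0`,
`|λ_ν(x + e_μ) − λ_ν(x)| ≤ 14κ` (evenness of `Λ^ν` under the mirror at `−1/2` of direction `μ` turns the normal
difference into a second difference). [folklore] -/
private theorem lamDir_face_lo (hN : ∀ μ, 3 ≤ N μ) {κ : ℝ}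
    (hreg : ∀ x ∈ boxDom N, ∀ i ν : Fin (d + 1), |Ac (x + e1 i) ν - Ac x ν| ≤ κ)
    {x : Fin (d + 1) → ℤ} (hx : x ∈ boxDom N) {μ ν : Fin (d + 1)} (hνμ : ν ≠ μ) (hxμ : x μ = 0) :
    |lamDir N Ac ν (x + e1 μ) - lamDir N Ac ν x| ≤ 14 * κ := by
  obtain ⟨hc, hG, hGlip, hδlip, -⟩ := faceData_runHyps hN hreg ν
  have hn : (x ν).toNat ≤ cLen N ν + 1 := by
    have := ((mem_boxDom).1 hx ν).2; have := hN ν; unfold cLen; omega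
  have e : lamDir N Ac ν (x + e1 μ) - lamDir N Ac ν x
      = -(runSum (cLen N ν) (faceData N Ac ν) (x ν).toNat (x + e1 μ)
          - runSum (cLen N ν) (faceData N Ac ν) (x ν).toNat x) := by
    rw [lamDir_of_apply_eq ν (e1_apply_ne hνμ : e1 μ ν = 0), lamDir]; ring
  have hev : ∀ w, runSum (cLen N ν) (faceData N Ac ν) (x ν).toNat (reflC μ (-1) w)
      = runSum (cLen N ν) (faceData N Ac ν) (x ν).toNat w :=
    fun w => runSum_reflC (fun s w' => faceData_reflC_lo hN ν s μ w') _ w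
  rw [e, abs_neg, dDir_of_even_lo hev hxμ]
  exact d2_runSum_le hc hG hGlip hδlip hn μ μ _

/-- the tangential gauge terms at an upper face are `O(κ)`. [folklore] -/
private theorem lamDir_face_hi (hN : ∀ μ, 3 ≤ N μ) {κ : ℝ}
    (hreg : ∀ x ∈ boxDom N, ∀ i ν : Fin (d + 1), |Ac (x + e1 i) ν - Ac x ν| ≤ κ)
    {x : Fin (d + 1) → ℤ} (hx : x ∈ boxDom N) {μ ν : Fin (d + 1)} (hνμ : ν ≠ μ) (hxμ : x μ = (N μ : ℤ) - 2) :
    |lamDir N Ac ν (x + e1 μ) - lamDir N Ac ν x| ≤ 14 * κ := by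
  obtain ⟨hc, hG, hGlip, hδlip, -⟩ := faceData_runHyps hN hreg ν
  have hn : (x ν).toNat ≤ cLen N ν + 1 := by
    have := ((mem_boxDom).1 hx ν).2; have := hN ν; unfold cLen; omega
  have e : lamDir N Ac ν (x + e1 μ) - lamDir N Ac ν x
      = -(runSum (cLen N ν) (faceData N Ac ν) (x ν).toNat (x + e1 μ)
          - runSum (cLen N ν) (faceData N Ac ν) (x ν).toNat x) := by
    rw [lamDir_of_apply_eq ν (e1_apply_ne hνμ : e1 μ ν = 0), lamDir]; ring
  have hev : ∀ w, runSum (cLen N ν) (faceData N Ac ν) (x ν).toNat (reflC μ (2 * (N μ : ℤ) - 1) w)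
      = runSum (cLen N ν) (faceData N Ac ν) (x ν).toNat w :=
    fun w => runSum_reflC (fun s w' => faceData_reflC_hi hN ν s μ w') _ w
  rw [e, abs_neg, dDir_of_even_hi hev hxμ, abs_neg]
  exact d2_runSum_le hc hG hGlip hδlip hn μ μ _

/-- **THE NORMAL GAUGE TERM AT THE LOWER FACE CANCELS THE FIELD**: `λ_μ(x + e_μ) − λ_μ(x) = −A_μ(x)` at `x_μ = 0`.
[cite: Balaban1983RegularityDecay, p.577 «constant in a neighbourhood of the boundary of □», dictionary] -/
theorem lamDir_self_lo (hN : ∀ μ, 3 ≤ N μ) {x : Fin (d + 1) → ℤ} (hx : x ∈ boxDom N) {μ : Fin (d + 1)}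
    (hxμ : x μ = 0) : lamDir N Ac μ (x + e1 μ) - lamDir N Ac μ x = -Ac x μ := by
  have hN1 : ∀ μ, 1 ≤ N μ := fun μ => le_trans (by norm_num) (hN μ)
  rw [lamDir_step μ (by omega)]
  have hn : (x μ).toNat = 0 := by omega
  rw [hn, mrun_zero, pk_zero, faceData_zero hN]
  simp only [faceLo, foldBox_eq_self_of_mem hN1 hx]
  rw [← hxμ, Function.update_eq_self]

/-- the normal gauge term at the upper face cancels the field: `λ_μ(x + e_μ) − λ_μ(x) = −A_μ(x)` at
`x_μ = N_μ − 2`. [cite: Balaban1983RegularityDecay, p.577 «constant in a neighbourhood of the boundary of □», dictionary] -/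
theorem lamDir_self_hi (hN : ∀ μ, 3 ≤ N μ) {x : Fin (d + 1) → ℤ} (hx : x ∈ boxDom N) {μ : Fin (d + 1)}
    (hxμ : x μ = (N μ : ℤ) - 2) : lamDir N Ac μ (x + e1 μ) - lamDir N Ac μ x = -Ac x μ := by
  have hN1 : ∀ μ, 1 ≤ N μ := fun μ => le_trans (by norm_num) (hN μ)
  have h3 := hN μ
  rw [lamDir_step μ (by omega)]
  have hn : (x μ).toNat = cLen N μ := by unfold cLen; omega
  rw [hn, mrun_self, pk_zero, faceData_cLen hN]
  simp only [faceHi, foldBox_eq_self_of_mem hN1 hx]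
  rw [← hxμ, Function.update_eq_self]

/-- the gauged normal component at a face is the sum of the tangential gauge terms. [folklore] -/
private theorem gauged_face_eq {x : Fin (d + 1) → ℤ} {μ : Fin (d + 1)}
    (hself : lamDir N Ac μ (x + e1 μ) - lamDir N Ac μ x = -Ac x μ) :
    gauged N Ac x μ = ∑ ν ∈ Finset.univ.erase μ, (lamDir N Ac ν (x + e1 μ) - lamDir N Ac ν x) := by
  unfold gauged gaugeFn
  rw [add_sub_assoc, ← Finset.sum_sub_distrib, ← Finset.add_sum_erase _ _ (Finset.mem_univ μ), hself]
  ring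

/-- **THE GAUGED FIELD HAS SMALL NORMAL COMPONENTS ON THE FIRST BOND LAYER OF EVERY FACE**:
`|A''_μ(x)| ≤ 14dκ` for `x` in the box with `x_μ = 0`. [cite: Balaban1983RegularityDecay, p.579 «we can apply Lemma 2.2 to all operators in it», p.577 «constant in a neighbourhood of the boundary of □»] -/
theorem gauged_face_lo (hN : ∀ μ, 3 ≤ N μ) {κ : ℝ}
    (hreg : ∀ x ∈ boxDom N, ∀ i ν : Fin (d + 1), |Ac (x + e1 i) ν - Ac x ν| ≤ κ)
    {x : Fin (d + 1) → ℤ} (hx : x ∈ boxDom N) {μ : Fin (d + 1)} (hxμ : x μ = 0) :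
    |gauged N Ac x μ| ≤ C2 d * κ := by
  rw [gauged_face_eq (lamDir_self_lo hN hx hxμ)]
  calc |∑ ν ∈ Finset.univ.erase μ, (lamDir N Ac ν (x + e1 μ) - lamDir N Ac ν x)|
      ≤ ∑ ν ∈ Finset.univ.erase μ, |lamDir N Ac ν (x + e1 μ) - lamDir N Ac ν x| := Finset.abs_sum_le_sum_abs _ _
    _ ≤ ∑ _ν ∈ Finset.univ.erase μ, 14 * κ :=
        Finset.sum_le_sum fun ν hν => lamDir_face_lo hN hreg hx (Finset.ne_of_mem_erase hν) hxμ
    _ = C2 d * κ := by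
        rw [Finset.sum_const, Finset.card_erase_of_mem (Finset.mem_univ μ), Finset.card_univ, Fintype.card_fin,
          nsmul_eq_mul, C2]
        push_cast; ring

/-- **THE GAUGED FIELD HAS SMALL NORMAL COMPONENTS ON THE LAST BOND LAYER OF EVERY FACE**:
`|A''_μ(x)| ≤ 14dκ` for `x` in the box with `x_μ = N_μ − 2`. [cite: Balaban1983RegularityDecay, p.579 «we can apply Lemma 2.2 to all operators in it», p.577 «constant in a neighbourhood of the boundary of □»] -/
theorem gauged_face_hi (hN : ∀ μ, 3 ≤ N μ) {κ : ℝ}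
    (hreg : ∀ x ∈ boxDom N, ∀ i ν : Fin (d + 1), |Ac (x + e1 i) ν - Ac x ν| ≤ κ)
    {x : Fin (d + 1) → ℤ} (hx : x ∈ boxDom N) {μ : Fin (d + 1)} (hxμ : x μ = (N μ : ℤ) - 2) :
    |gauged N Ac x μ| ≤ C2 d * κ := by
  rw [gauged_face_eq (lamDir_self_hi hN hx hxμ)]
  calc |∑ ν ∈ Finset.univ.erase μ, (lamDir N Ac ν (x + e1 μ) - lamDir N Ac ν x)|
      ≤ ∑ ν ∈ Finset.univ.erase μ, |lamDir N Ac ν (x + e1 μ) - lamDir N Ac ν x| := Finset.abs_sum_le_sum_abs _ _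
    _ ≤ ∑ _ν ∈ Finset.univ.erase μ, 14 * κ :=
        Finset.sum_le_sum fun ν hν => lamDir_face_hi hN hreg hx (Finset.ne_of_mem_erase hν) hxμ
    _ = C2 d * κ := by
        rw [Finset.sum_const, Finset.card_erase_of_mem (Finset.mem_univ μ), Finset.card_univ, Fintype.card_fin,
          nsmul_eq_mul, C2]
        push_cast; ring

/-- **EVERY DIRECTION'S GAUGE TERM HAS BOUNDED MIXED SECOND DIFFERENCES INSIDE THE BOX**:
`|λ_μ(x+e_i+e_ν) − λ_μ(x+e_i) − λ_μ(x+e_ν) + λ_μ(x)| ≤ (4(d+1)² + 9(d+1) + 16)κ` whenever the four points lie in the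
box (four cases: `μ ∉ {i,ν}` — second differences of `Λ^μ`; `μ = ν ≠ i` or `μ = i ≠ ν` — a tangential step of
`P_{m}G^μ`; `μ = i = ν` — a normal step). [folklore] -/
private theorem lamDir_d2_le (hN : ∀ μ, 3 ≤ N μ) {κ : ℝ}
    (hreg : ∀ x ∈ boxDom N, ∀ i ν : Fin (d + 1), |Ac (x + e1 i) ν - Ac x ν| ≤ κ)
    {x : Fin (d + 1) → ℤ} {i ν : Fin (d + 1)} (hx : x ∈ boxDom N) (hxi : x + e1 i ∈ boxDom N)
    (hxν : x + e1 ν ∈ boxDom N) (hxiν : x + e1 i + e1 ν ∈ boxDom N) (μ : Fin (d + 1)) :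
    |lamDir N Ac μ (x + e1 i + e1 ν) - lamDir N Ac μ (x + e1 i) - lamDir N Ac μ (x + e1 ν) + lamDir N Ac μ x|
      ≤ (4 * (d + 1 : ℝ) ^ 2 + 9 * (d + 1 : ℝ) + 16) * κ := by
  obtain ⟨hc, hG, hGlip, hδlip, hδbd⟩ := faceData_runHyps hN hreg μ
  have hκ : 0 ≤ κ := (abs_nonneg _).trans (hδbd 0)
  have hD : (0 : ℝ) ≤ d + 1 := by positivity
  have hx0 : 0 ≤ x μ := ((mem_boxDom).1 hx μ).1
  have h3 := hN μ
  by_cases hμi : μ = i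
  · subst hμi
    by_cases hμν : μ = ν
    · subst hμν
      -- normal step: `−P_{m(n+1)}G_{n+1} + P_{m(n)}G_n`
      have hn : (x μ).toNat ≤ cLen N μ := by
        have := ((mem_boxDom).1 hxiν μ).2; simp at this; unfold cLen; omega
      have e : lamDir N Ac μ (x + e1 μ + e1 μ) - lamDir N Ac μ (x + e1 μ) - lamDir N Ac μ (x + e1 μ)
            + lamDir N Ac μ x
          = (lamDir N Ac μ (x + e1 μ + e1 μ) - lamDir N Ac μ (x + e1 μ))
            - (lamDir N Ac μ (x + e1 μ) - lamDir N Ac μ x) := by ring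
      have hstep1 := lamDir_step (N := N) (Ac := Ac) μ (y := x + e1 μ) (by simp; omega)
      have hn1 : ((x + e1 μ) μ).toNat = (x μ).toNat + 1 := by simp; omega
      rw [hn1] at hstep1
      rw [e, hstep1, lamDir_step μ hx0, ← pk_shift, show (fun w => faceData N Ac μ ((x μ).toNat + 1) (w + e1 μ))
        = faceData N Ac μ ((x μ).toNat + 1) from funext fun w => faceData_add_e1 μ _ w]
      rw [show -pk (mrun (cLen N μ) ((x μ).toNat + 1)) (faceData N Ac μ ((x μ).toNat + 1)) x
          - -pk (mrun (cLen N μ) (x μ).toNat) (faceData N Ac μ (x μ).toNat) x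
          = -(pk (mrun (cLen N μ) ((x μ).toNat + 1)) (faceData N Ac μ ((x μ).toNat + 1)) x
            - pk (mrun (cLen N μ) (x μ).toNat) (faceData N Ac μ (x μ).toNat) x) by ring, abs_neg]
      refine (pk_run_step_le hG hGlip hδbd hn x).trans ?_
      nlinarith
    · -- `μ = i ≠ ν`: a tangential step (direction `ν`) of `P_{m(n)}G_n`
      have hn : (x μ).toNat ≤ cLen N μ := by
        have := ((mem_boxDom).1 hxi μ).2; simp at this; unfold cLen; omega
      have e : lamDir N Ac μ (x + e1 μ + e1 ν) - lamDir N Ac μ (x + e1 μ) - lamDir N Ac μ (x + e1 ν)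
            + lamDir N Ac μ x
          = (lamDir N Ac μ (x + e1 ν + e1 μ) - lamDir N Ac μ (x + e1 ν))
            - (lamDir N Ac μ (x + e1 μ) - lamDir N Ac μ x) := by rw [add_right_comm]; ring
      have hstep1 := lamDir_step (N := N) (Ac := Ac) μ (y := x + e1 ν) (by simp [e1_apply_ne hμν]; omega)
      have hn1 : ((x + e1 ν) μ).toNat = (x μ).toNat := by simp [e1_apply_ne hμν]
      rw [hn1] at hstep1
      rw [e, hstep1, lamDir_step μ hx0]
      rw [show -pk (mrun (cLen N μ) (x μ).toNat) (faceData N Ac μ (x μ).toNat) (x + e1 ν)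
          - -pk (mrun (cLen N μ) (x μ).toNat) (faceData N Ac μ (x μ).toNat) x
          = -(pk (mrun (cLen N μ) (x μ).toNat) (faceData N Ac μ (x μ).toNat) (x + e1 ν)
            - pk (mrun (cLen N μ) (x μ).toNat) (faceData N Ac μ (x μ).toNat) x) by ring, abs_neg]
      refine (dDir_pk_run_le hGlip hn ν x).trans ?_
      nlinarith
  · by_cases hμν : μ = ν
    · subst hμν
      -- `μ = ν ≠ i`: a tangential step (direction `i`) of `P_{m(n)}G_n`
      have hn : (x μ).toNat ≤ cLen N μ := by
        have := ((mem_boxDom).1 hxν μ).2; simp at this; unfold cLen; omega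
      have e : lamDir N Ac μ (x + e1 i + e1 μ) - lamDir N Ac μ (x + e1 i) - lamDir N Ac μ (x + e1 μ)
            + lamDir N Ac μ x
          = (lamDir N Ac μ (x + e1 i + e1 μ) - lamDir N Ac μ (x + e1 i))
            - (lamDir N Ac μ (x + e1 μ) - lamDir N Ac μ x) := by ring
      have hstep1 := lamDir_step (N := N) (Ac := Ac) μ (y := x + e1 i) (by simp [e1_apply_ne hμi]; omega)
      have hn1 : ((x + e1 i) μ).toNat = (x μ).toNat := by simp [e1_apply_ne hμi]
      rw [hn1] at hstep1
      rw [e, hstep1, lamDir_step μ hx0]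
      rw [show -pk (mrun (cLen N μ) (x μ).toNat) (faceData N Ac μ (x μ).toNat) (x + e1 i)
          - -pk (mrun (cLen N μ) (x μ).toNat) (faceData N Ac μ (x μ).toNat) x
          = -(pk (mrun (cLen N μ) (x μ).toNat) (faceData N Ac μ (x μ).toNat) (x + e1 i)
            - pk (mrun (cLen N μ) (x μ).toNat) (faceData N Ac μ (x μ).toNat) x) by ring, abs_neg]
      refine (dDir_pk_run_le hGlip hn i x).trans ?_
      nlinarith
    · -- `μ ∉ {i, ν}`: second differences of `Λ^μ_n`
      have hn : (x μ).toNat ≤ cLen N μ + 1 := by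
        have := ((mem_boxDom).1 hx μ).2; unfold cLen; omega
      have hvi : e1 i μ = 0 := e1_apply_ne hμi
      have hvν : e1 ν μ = 0 := e1_apply_ne hμν
      have hviν : (e1 i + e1 ν) μ = 0 := by simp [hvi, hvν]
      rw [add_assoc x, lamDir_of_apply_eq μ hviν, lamDir_of_apply_eq μ hvi, lamDir_of_apply_eq μ hvν, lamDir,
        ← add_assoc]
      have h := d2_runSum_le hc hG hGlip hδlip hn i ν x
      simp only [d2] at h
      rw [show -runSum (cLen N μ) (faceData N Ac μ) (x μ).toNat (x + e1 i + e1 ν)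
          - -runSum (cLen N μ) (faceData N Ac μ) (x μ).toNat (x + e1 i)
          - -runSum (cLen N μ) (faceData N Ac μ) (x μ).toNat (x + e1 ν)
          + -runSum (cLen N μ) (faceData N Ac μ) (x μ).toNat x
          = -(runSum (cLen N μ) (faceData N Ac μ) (x μ).toNat (x + e1 i + e1 ν)
            - runSum (cLen N μ) (faceData N Ac μ) (x μ).toNat (x + e1 i)
            - runSum (cLen N μ) (faceData N Ac μ) (x μ).toNat (x + e1 ν)
            + runSum (cLen N μ) (faceData N Ac μ) (x μ).toNat x) by ring, abs_neg]
      refine h.trans ?_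
      nlinarith

/-- **THE GAUGED FIELD IS (1.7)-REGULAR INSIDE THE BOX** with constant `C₁(d)κ`: for every pair of parallel bonds
`(x, x+e_ν)`, `(x+e_i, x+e_i+e_ν)` of the box. [cite: Balaban1983RegularityDecay, (1.7) p.572, p.579 «we can apply Lemma 2.2 to all operators in it»] -/
theorem gauged_regular (hN : ∀ μ, 3 ≤ N μ) {κ : ℝ}
    (hreg : ∀ x ∈ boxDom N, ∀ i ν : Fin (d + 1), |Ac (x + e1 i) ν - Ac x ν| ≤ κ)
    {x : Fin (d + 1) → ℤ} {i ν : Fin (d + 1)} (hx : x ∈ boxDom N) (hxi : x + e1 i ∈ boxDom N)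
    (hxν : x + e1 ν ∈ boxDom N) (hxiν : x + e1 i + e1 ν ∈ boxDom N) :
    |gauged N Ac (x + e1 i) ν - gauged N Ac x ν| ≤ C1 d * κ := by
  have e : gauged N Ac (x + e1 i) ν - gauged N Ac x ν
      = (Ac (x + e1 i) ν - Ac x ν)
        + ∑ μ, (lamDir N Ac μ (x + e1 i + e1 ν) - lamDir N Ac μ (x + e1 i) - lamDir N Ac μ (x + e1 ν)
          + lamDir N Ac μ x) := by
    simp only [gauged, gaugeFn, Finset.sum_add_distrib, Finset.sum_sub_distrib]; ring
  rw [e]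
  calc |(Ac (x + e1 i) ν - Ac x ν)
          + ∑ μ, (lamDir N Ac μ (x + e1 i + e1 ν) - lamDir N Ac μ (x + e1 i) - lamDir N Ac μ (x + e1 ν)
            + lamDir N Ac μ x)|
      ≤ |Ac (x + e1 i) ν - Ac x ν|
          + ∑ μ, |lamDir N Ac μ (x + e1 i + e1 ν) - lamDir N Ac μ (x + e1 i) - lamDir N Ac μ (x + e1 ν)
            + lamDir N Ac μ x| := (abs_add_le _ _).trans (add_le_add le_rfl (Finset.abs_sum_le_sum_abs _ _))
    _ ≤ κ + ∑ _μ : Fin (d + 1), (4 * (d + 1 : ℝ) ^ 2 + 9 * (d + 1 : ℝ) + 16) * κ :=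
        add_le_add (hreg x hx i ν) (Finset.sum_le_sum fun μ _ => lamDir_d2_le hN hreg hx hxi hxν hxiν μ)
    _ = C1 d * κ := by
        rw [Finset.sum_const, Finset.card_univ, Fintype.card_fin, nsmul_eq_mul, C1]; push_cast; ring

/-- **THE GAUGED FIELD IS A LATTICE GAUGE TRANSFORM OF `A`** in the lineage's sense: on every bond `(u, u + e_ν)`
its bond function is `bondGauge (−λ) A`. [cite: Balaban1983RegularityDecay, pp.580–581 (gauge transformations), dictionary] -/
theorem compField_gauged (u : Fin (d + 1) → ℤ) (ν : Fin (d + 1)) :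
    compField (gauged N Ac) u (u + e1 ν)
      = B4GaugeCovariance.bondGauge (fun w => -gaugeFn N Ac w) (compField Ac) u (u + e1 ν) := by
  rw [compField_add, B4GaugeCovariance.bondGauge, compField_add, gauged]; ring

/-- the same on the reversed bond `(u + e_ν, u)`. [cite: Balaban1983RegularityDecay, pp.580–581 (gauge transformations), dictionary] -/
theorem compField_gauged_rev (u : Fin (d + 1) → ℤ) (ν : Fin (d + 1)) :
    compField (gauged N Ac) (u + e1 ν) u
      = B4GaugeCovariance.bondGauge (fun w => -gaugeFn N Ac w) (compField Ac) (u + e1 ν) u := by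
  rw [compField_sub, B4GaugeCovariance.bondGauge, compField_sub, gauged]; ring

end Gauge

/-! ## §6. The reflected `2N`-periodic field `R*A''` (pullback along the box folding; mirror bonds carry `0`) is
(1.7)-regular on all of `ℤ^{d+1}` -/

section Reflect

/-- the residue of a successor modulo `2N`. [folklore] -/
private theorem emod_two_mul_succ {N : ℕ} (hN : 1 ≤ N) (n : ℤ) :
    (n + 1) % (2 * N : ℤ) = if n % (2 * N : ℤ) + 1 < 2 * N then n % (2 * N : ℤ) + 1 else 0 := by
  have h0 : 0 ≤ n % (2 * N : ℤ) := Int.emod_nonneg _ (by omega)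
  rw [(Int.emod_add_emod n (2 * N) 1).symm]
  split_ifs with h
  · exact Int.emod_eq_of_lt (by omega) h
  · have h1 : n % (2 * N : ℤ) < 2 * N := Int.emod_lt_of_pos _ (by omega)
    have e : n % (2 * N : ℤ) + 1 = 2 * N := by omega
    rw [e, Int.emod_self]

/-- **TWO CONSECUTIVE FOLDED STEPS**: the six possible shapes of `(fold1 n, fold1 (n+1), fold1 (n+2))` — up-up,
up-stall (at the top), stall-down (from the top), down-down, down-stall (at the bottom), stall-up (from the bottom).
[folklore] -/
private theorem fold1_two_steps {N : ℕ} (hN : 2 ≤ N) (n : ℤ) :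
    (fold1 N (n + 1) = fold1 N n + 1 ∧
        (fold1 N (n + 2) = fold1 N n + 2 ∨ (fold1 N (n + 2) = fold1 N n + 1 ∧ fold1 N n + 2 = N))) ∨
      (fold1 N (n + 1) = fold1 N n ∧ fold1 N n + 1 = N ∧ fold1 N (n + 2) + 2 = N) ∨
      (fold1 N (n + 1) + 1 = fold1 N n ∧
        (fold1 N (n + 2) + 2 = fold1 N n ∨ (fold1 N (n + 2) = 0 ∧ fold1 N (n + 1) = 0))) ∨
      (fold1 N (n + 1) = fold1 N n ∧ fold1 N n = 0 ∧ fold1 N (n + 2) = 1) := by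
  have hN1 : 1 ≤ N := by omega
  have h0 : 0 ≤ n % (2 * N : ℤ) := Int.emod_nonneg _ (by omega)
  have h1 : n % (2 * N : ℤ) < 2 * N := Int.emod_lt_of_pos _ (by omega)
  have hs1 := emod_two_mul_succ hN1 n
  have hs2 := emod_two_mul_succ hN1 (n + 1)
  rw [show n + 1 + 1 = n + 2 by ring, hs1] at hs2
  unfold fold1
  rw [hs2, hs1]
  split_ifs <;> omega

variable {N : Fin (d + 1) → ℕ}

/-- an upward folded step. [folklore] -/
private theorem foldBox_step_up {z : Fin (d + 1) → ℤ} {ν : Fin (d + 1)}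
    (h : fold1 (N ν) (z ν + 1) = fold1 (N ν) (z ν) + 1) : foldBox N (z + e1 ν) = foldBox N z + e1 ν := by
  rw [foldBox_add_e1, h, ← foldBox_apply N z ν, update_add_eq, one_zsmul]

/-- a stalled folded step (a mirror is crossed). [folklore] -/
private theorem foldBox_step_stay {z : Fin (d + 1) → ℤ} {ν : Fin (d + 1)}
    (h : fold1 (N ν) (z ν + 1) = fold1 (N ν) (z ν)) : foldBox N (z + e1 ν) = foldBox N z := by
  rw [foldBox_add_e1, h, ← foldBox_apply N z ν, Function.update_eq_self]

/-- a downward folded step (reflected copy). [folklore] -/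
private theorem foldBox_step_down {z : Fin (d + 1) → ℤ} {ν : Fin (d + 1)}
    (h : fold1 (N ν) (z ν + 1) + 1 = fold1 (N ν) (z ν)) : foldBox N (z + e1 ν) = foldBox N z - e1 ν := by
  rw [foldBox_add_e1, show fold1 (N ν) (z ν + 1) = fold1 (N ν) (z ν) + (-1) by omega, ← foldBox_apply N z ν,
    update_add_eq, neg_one_zsmul, sub_eq_add_neg]

/-- two folded steps in the same direction. [folklore] -/
private theorem foldBox_add_e1_e1 (N : Fin (d + 1) → ℕ) (z : Fin (d + 1) → ℤ) (ν : Fin (d + 1)) :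
    foldBox N (z + e1 ν + e1 ν) = Function.update (foldBox N z) ν (fold1 (N ν) (z ν + 2)) := by
  rw [foldBox_add_e1, foldBox_add_e1, Function.update_idem]
  congr 2
  simp; ring

/-- the value of a component field on a degenerate pair vanishes. [folklore] -/
private theorem compField_self (B : (Fin (d + 1) → ℤ) → Fin (d + 1) → ℝ) (x : Fin (d + 1) → ℤ) : compField B x x = 0 := by
  unfold compField
  have h : ∀ ν : Fin (d + 1), ¬ (x = x + e1 ν) := by
    intro ν hx
    have := congrFun hx ν
    simp at this
  simp [h]

/-- the value of a component field on a reversed bond. [folklore] -/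
private theorem compField_sub' (B : (Fin (d + 1) → ℤ) → Fin (d + 1) → ℝ) (x : Fin (d + 1) → ℤ) (ν : Fin (d + 1)) :
    compField B x (x - e1 ν) = -B (x - e1 ν) ν := by
  have h := compField_sub B (x - e1 ν) ν
  rwa [sub_add_cancel] at h

variable (N)

/-- **THE REFLECTED FIELD** `R*B` on `ℤ^{d+1}`: the value on the bond `(z, z + e_ν)` is the value of `B` on the folded
bond `(fold z, fold(z + e_ν))` of the box, with its orientation (odd normal components across the mirrors, even
tangential ones), and `0` on the bonds bisected by a mirror. [cite: Balaban1983RegularityDecay, (2.42) p.584 (multiple reflections), dictionary] -/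
def reflField (B : (Fin (d + 1) → ℤ) → Fin (d + 1) → ℝ) : (Fin (d + 1) → ℤ) → Fin (d + 1) → ℝ :=
  fun z ν => compField B (foldBox N z) (foldBox N (z + e1 ν))

variable {N}

/-- **ON THE BOX THE REFLECTED FIELD IS THE FIELD**. [cite: Balaban1983RegularityDecay, (2.42) p.584, dictionary] -/
theorem reflField_of_mem (hN : ∀ μ, 1 ≤ N μ) (B : (Fin (d + 1) → ℤ) → Fin (d + 1) → ℝ) {z : Fin (d + 1) → ℤ}
    {ν : Fin (d + 1)} (hz : z ∈ boxDom N) (hzν : z + e1 ν ∈ boxDom N) : reflField N B z ν = B z ν := by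
  unfold reflField
  rw [foldBox_eq_self_of_mem hN hz, foldBox_eq_self_of_mem hN hzν, compField_add]

/-- **THE REFLECTED FIELD IS `2N`-PERIODIC** in every direction. [cite: Balaban1983RegularityDecay, (2.42) p.584, dictionary] -/
theorem reflField_periodic (B : (Fin (d + 1) → ℤ) → Fin (d + 1) → ℝ) (z t : Fin (d + 1) → ℤ) (ν : Fin (d + 1)) :
    reflField N B (z + fun μ => 2 * (N μ : ℤ) * t μ) ν = reflField N B z ν := by
  have hf : ∀ w : Fin (d + 1) → ℤ, foldBox N (w + fun μ => 2 * (N μ : ℤ) * t μ) = foldBox N w := by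
    intro w; funext k; simp only [foldBox_apply, Pi.add_apply]; exact fold1_add_mul (N k) (w k) (t k)
  unfold reflField
  rw [add_right_comm, hf, hf]

/-- **THE REFLECTED FIELD OF A BOX FIELD WITH SMALL FACE-NORMAL COMPONENTS IS (1.7)-REGULAR EVERYWHERE**: if
`|B_μ| ≤ a` on both normal bond layers of every face and `|∂_i B_ν| ≤ b` on parallel box bonds, then
`|(R*B)_ν(z + e_i) − (R*B)_ν(z)| ≤ max a b` for all `z ∈ ℤ^{d+1}`. [cite: Balaban1983RegularityDecay, (1.7) p.572, (2.42) p.584] -/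
theorem reflField_regular (hN : ∀ μ, 3 ≤ N μ) {B : (Fin (d + 1) → ℤ) → Fin (d + 1) → ℝ} {a b : ℝ}
    (hlo : ∀ x ∈ boxDom N, ∀ μ, x μ = 0 → |B x μ| ≤ a)
    (hhi : ∀ x ∈ boxDom N, ∀ μ, x μ = (N μ : ℤ) - 2 → |B x μ| ≤ a)
    (hin : ∀ (x : Fin (d + 1) → ℤ) (i ν : Fin (d + 1)), x ∈ boxDom N → x + e1 i ∈ boxDom N → x + e1 ν ∈ boxDom N →
      x + e1 i + e1 ν ∈ boxDom N → |B (x + e1 i) ν - B x ν| ≤ b)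
    (z : Fin (d + 1) → ℤ) (i ν : Fin (d + 1)) :
    |reflField N B (z + e1 i) ν - reflField N B z ν| ≤ max a b := by
  have hN1 : ∀ μ, 1 ≤ N μ := fun μ => le_trans (by norm_num) (hN μ)
  have hmem : ∀ w : Fin (d + 1) → ℤ, foldBox N w ∈ boxDom N := fun w => foldBox_mem_boxDom hN1 w
  have h0mem : (0 : Fin (d + 1) → ℤ) ∈ boxDom N :=
    (mem_boxDom).2 fun k => ⟨le_rfl, by have := hN1 k; simp only [Pi.zero_apply]; omega⟩
  have ha : 0 ≤ a := (abs_nonneg _).trans (hlo 0 h0mem i rfl)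
  have hamax : a ≤ max a b := le_max_left a b
  have hbmax : b ≤ max a b := le_max_right a b
  have h0max : 0 ≤ max a b := ha.trans hamax
  unfold reflField
  by_cases hiν : i = ν
  · subst hiν
    have h2 := foldBox_add_e1_e1 N z i
    rcases fold1_two_steps (le_trans (by norm_num) (hN i)) (z i) with
      ⟨h1, hA | ⟨hB, htop⟩⟩ | ⟨h1, htop, hC⟩ | ⟨h1, hD | ⟨hE, hbot⟩⟩ | ⟨h1, hbot, hF⟩
    · -- up, up
      have e1' : foldBox N (z + e1 i) = foldBox N z + e1 i := foldBox_step_up h1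
      have e2' : foldBox N (z + e1 i + e1 i) = foldBox N z + e1 i + e1 i := by
        rw [h2, hA, ← foldBox_apply N z i, update_add_eq, two_zsmul, add_assoc]
      rw [e1', e2', compField_add, compField_add]
      refine (hin _ i i (hmem z) (e1' ▸ hmem _) (e1' ▸ hmem _) (e2' ▸ hmem _)).trans hbmax
    · -- up, stall at the top
      have e1' : foldBox N (z + e1 i) = foldBox N z + e1 i := foldBox_step_up h1
      have e2' : foldBox N (z + e1 i + e1 i) = foldBox N z + e1 i := by
        rw [h2, hB, ← foldBox_apply N z i, update_add_eq, one_zsmul]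
      rw [e1', e2', compField_self, compField_add, zero_sub, abs_neg]
      have htop' : (foldBox N z) i = (N i : ℤ) - 2 := by rw [foldBox_apply]; omega
      exact (hhi _ (hmem z) i htop').trans hamax
    · -- stall at the top, down
      have e1' : foldBox N (z + e1 i) = foldBox N z := foldBox_step_stay h1
      have e2' : foldBox N (z + e1 i + e1 i) = foldBox N z - e1 i := by
        rw [h2, show fold1 (N i) (z i + 2) = fold1 (N i) (z i) + (-1) by omega, ← foldBox_apply N z i,
          update_add_eq, neg_one_zsmul, sub_eq_add_neg]
      rw [e1', e2', compField_self, compField_sub', sub_zero, abs_neg]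
      have htop' : (foldBox N z - e1 i) i = (N i : ℤ) - 2 := by simp; omega
      exact (hhi _ (e2' ▸ hmem _) i htop').trans hamax
    · -- down, down
      have e1' : foldBox N (z + e1 i) = foldBox N z - e1 i := foldBox_step_down h1
      have e2' : foldBox N (z + e1 i + e1 i) = foldBox N z - e1 i - e1 i := by
        rw [h2, show fold1 (N i) (z i + 2) = fold1 (N i) (z i) + (-2) by omega, ← foldBox_apply N z i,
          update_add_eq, neg_zsmul, two_zsmul]; abel
      rw [e1', e2', compField_sub', show foldBox N z - e1 i - e1 i = (foldBox N z - e1 i) - e1 i by rfl,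
        compField_sub']
      have h := hin (foldBox N z - e1 i - e1 i) i i (e2' ▸ hmem _) (by rw [sub_add_cancel]; exact e1' ▸ hmem _)
        (by rw [sub_add_cancel]; exact e1' ▸ hmem _) (by rw [sub_add_cancel, sub_add_cancel]; exact hmem z)
      rw [sub_add_cancel] at h
      rw [show -B (foldBox N z - e1 i - e1 i) i - -B (foldBox N z - e1 i) i
          = B (foldBox N z - e1 i) i - B (foldBox N z - e1 i - e1 i) i by ring]
      exact h.trans hbmax
    · -- down, stall at the bottom
      have e1' : foldBox N (z + e1 i) = foldBox N z - e1 i := foldBox_step_down h1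
      have e2' : foldBox N (z + e1 i + e1 i) = foldBox N z - e1 i := by
        rw [h2, show fold1 (N i) (z i + 2) = fold1 (N i) (z i) + (-1) by omega, ← foldBox_apply N z i,
          update_add_eq, neg_one_zsmul, sub_eq_add_neg]
      rw [e1', e2', compField_self, compField_sub', zero_sub, neg_neg]
      have hbot' : (foldBox N z - e1 i) i = 0 := by simp; omega
      exact (hlo _ (e1' ▸ hmem _) i hbot').trans hamax
    · -- stall at the bottom, up
      have e1' : foldBox N (z + e1 i) = foldBox N z := foldBox_step_stay h1
      have e2' : foldBox N (z + e1 i + e1 i) = foldBox N z + e1 i := by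
        rw [h2, show fold1 (N i) (z i + 2) = fold1 (N i) (z i) + 1 by omega, ← foldBox_apply N z i,
          update_add_eq, one_zsmul]
      rw [e1', e2', compField_self, compField_add, sub_zero]
      have hbot' : (foldBox N z) i = 0 := by rw [foldBox_apply]; omega
      exact (hlo _ (hmem z) i hbot').trans hamax
  · -- different directions: the `ν`-step folds identically at `z` and at `z + e_i`
    have hzν : (z + e1 i) ν = z ν := by simp [e1_apply_ne (Ne.symm hiν)]
    have hN1i := hN1 i
    have hN1ν := hN1 ν
    rcases fold1_succ_trichotomy hN1ν (z ν) with hν1 | hν1 | hν1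
    · -- the `ν`-bond goes up at both points
      have eν : foldBox N (z + e1 ν) = foldBox N z + e1 ν := foldBox_step_up hν1
      have eν' : foldBox N (z + e1 i + e1 ν) = foldBox N (z + e1 i) + e1 ν :=
        foldBox_step_up (by rw [hzν]; exact hν1)
      rw [eν, eν', compField_add, compField_add]
      rcases fold1_succ_trichotomy hN1i (z i) with hi1 | hi1 | hi1
      · have ei : foldBox N (z + e1 i) = foldBox N z + e1 i := foldBox_step_up hi1
        rw [ei]
        exact (hin _ i ν (hmem z) (ei ▸ hmem _) (eν ▸ hmem _) (by rw [← ei, ← eν']; exact hmem _)).trans hbmax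
      · have ei : foldBox N (z + e1 i) = foldBox N z := foldBox_step_stay hi1
        rw [ei, sub_self, abs_zero]; exact h0max
      · have ei : foldBox N (z + e1 i) = foldBox N z - e1 i := foldBox_step_down (by omega)
        rw [ei]
        have h := hin (foldBox N z - e1 i) i ν (ei ▸ hmem _) (by rw [sub_add_cancel]; exact hmem z)
          (by rw [← ei, ← eν']; exact hmem _) (by rw [sub_add_cancel, ← eν]; exact hmem _)
        rw [sub_add_cancel] at h
        rw [abs_sub_comm]; exact h.trans hbmax
    · -- the `ν`-bond is bisected by a mirror at both points
      have eν : foldBox N (z + e1 ν) = foldBox N z := foldBox_step_stay hν1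
      have eν' : foldBox N (z + e1 i + e1 ν) = foldBox N (z + e1 i) := foldBox_step_stay (by rw [hzν]; exact hν1)
      rw [eν, eν', compField_self, compField_self, sub_self, abs_zero]; exact h0max
    · -- the `ν`-bond goes down at both points
      have eν : foldBox N (z + e1 ν) = foldBox N z - e1 ν := foldBox_step_down (by omega)
      have eν' : foldBox N (z + e1 i + e1 ν) = foldBox N (z + e1 i) - e1 ν :=
        foldBox_step_down (by rw [hzν]; omega)
      rw [eν, eν', compField_sub', compField_sub']
      rcases fold1_succ_trichotomy hN1i (z i) with hi1 | hi1 | hi1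
      · have ei : foldBox N (z + e1 i) = foldBox N z + e1 i := foldBox_step_up hi1
        rw [ei, show foldBox N z + e1 i - e1 ν = (foldBox N z - e1 ν) + e1 i by abel]
        have h := hin (foldBox N z - e1 ν) i ν (eν ▸ hmem _)
          (by rw [show foldBox N z - e1 ν + e1 i = foldBox N z + e1 i - e1 ν by abel, ← ei, ← eν']; exact hmem _)
          (by rw [sub_add_cancel]; exact hmem z)
          (by rw [show foldBox N z - e1 ν + e1 i + e1 ν = foldBox N z + e1 i by abel, ← ei]; exact hmem _)
        rw [show -B (foldBox N z - e1 ν + e1 i) ν - -B (foldBox N z - e1 ν) ν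
            = -(B (foldBox N z - e1 ν + e1 i) ν - B (foldBox N z - e1 ν) ν) by ring, abs_neg]
        exact h.trans hbmax
      · have ei : foldBox N (z + e1 i) = foldBox N z := foldBox_step_stay hi1
        rw [ei, sub_self, abs_zero]; exact h0max
      · have ei : foldBox N (z + e1 i) = foldBox N z - e1 i := foldBox_step_down (by omega)
        rw [ei]
        have h := hin (foldBox N z - e1 i - e1 ν) i ν (by rw [← ei, ← eν']; exact hmem _)
          (by rw [show foldBox N z - e1 i - e1 ν + e1 i = foldBox N z - e1 ν by abel, ← eν]; exact hmem _)
          (by rw [sub_add_cancel, ← ei]; exact hmem _)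
          (by rw [show foldBox N z - e1 i - e1 ν + e1 i + e1 ν = foldBox N z by abel]; exact hmem z)
        rw [show foldBox N z - e1 i - e1 ν + e1 i = foldBox N z - e1 ν by abel] at h
        rw [show -B (foldBox N z - e1 i - e1 ν) ν - -B (foldBox N z - e1 ν) ν
            = B (foldBox N z - e1 ν) ν - B (foldBox N z - e1 i - e1 ν) ν by ring]
        exact h.trans hbmax

/-- **THE MAIN THEOREM OF THIS FILE**: for a bond field `A` (1.7)-regular with constant `κ` on a box
`Π_μ [0, N_μ)` (`N_μ ≥ 3`), the reflected `2N`-periodic pullback of the gauged field `A'' = A + dλ` is (1.7)-regular on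
the whole lattice `ℤ^{d+1}` with constant `max(C₂(d), C₁(d))·κ`, and coincides with the gauge transform `A''` of `A` on
the bonds of the box (`reflField_of_mem`). [cite: Balaban1983RegularityDecay, (1.7) p.572, p.579 «if Ω is a rectangular parallelepiped, then all □_j in the representation (2.13) are cubes and we can apply Lemma 2.2 to all operators in it», p.577 «constant in a neighbourhood of the boundary of □»] -/
theorem reflField_gauged_regular {N : Fin (d + 1) → ℕ} (hN : ∀ μ, 3 ≤ N μ)
    {Ac : (Fin (d + 1) → ℤ) → Fin (d + 1) → ℝ} {κ : ℝ}
    (hreg : ∀ x ∈ boxDom N, ∀ i ν : Fin (d + 1), |Ac (x + e1 i) ν - Ac x ν| ≤ κ)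
    (z : Fin (d + 1) → ℤ) (i ν : Fin (d + 1)) :
    |reflField N (gauged N Ac) (z + e1 i) ν - reflField N (gauged N Ac) z ν| ≤ max (C2 d) (C1 d) * κ := by
  have hN1 : ∀ μ, 1 ≤ N μ := fun μ => le_trans (by norm_num) (hN μ)
  have hκ : 0 ≤ κ := (abs_nonneg _).trans (hreg _ (foldBox_mem_boxDom hN1 0) 0 0)
  rw [max_mul_of_nonneg _ _ hκ]
  exact reflField_regular hN (fun x hx μ hxμ => gauged_face_lo hN hreg hx hxμ)
    (fun x hx μ hxμ => gauged_face_hi hN hreg hx hxμ)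
    (fun x i ν hx hxi hxν hxiν => gauged_regular hN hreg hx hxi hxν hxiν) z i ν

end Reflect

end

end Literature.MathematicalPhysics.QuantumFieldTheory.Balaban1983to89.B4BoxNeumannGauge
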